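import Literature.Geometry.Lorentzian.KerrDeSitterRadialEnergyIdentity
import Literature.Geometry.Lorentzian.KerrDeSitterSurfaceGravities
import Literature.Geometry.Lorentzian.KerrDeSitterHiddenSymmetryKernel
import Literature.Geometry.Lorentzian.SchwarzschildDeSitterScalarModeStability
import HarnessLib

/-!
# Casals–Teixeira da Costa, proof of Theorem 3.10, Step 2: the energy identity for the
# `m₂ ↔ m₃`-transformed radial equation on subextremal Kerr–de Sitter (growing modes)

Theorems and definitions only (NO named facts). Source: M. Casals, R. Teixeira da Costa, *Hidden
spectral symmetries and mode stability of subextremal Kerr(-de Sitter) black holes*, Commun. Math.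
Phys. 394 (2022) 797–832, arXiv:2105.13329 [CasalsTeixeiradacosta2022]; held arXiv text = v1
(Theorem 3.11, Corollary 3.10, eqs. (3.25)–(3.29), pp. 17–18); the same material is Theorem 3.10 /
Corollary 3.9 in the published numbering (v3).

STEP 2 of the printed proof (v1 p. 17, "Step 2: the `m₂ ↔ m₃` symmetry"): let `R̃` solve the
transformed radial ODE (3.25), `z(z−1)(z−z₂) R̃″ + C̃(z) R̃ = 0` on `z ∈ (1, z₂)`, with the boundary
conditions (3.26) "`R̃(z)(z−1)^{−η₀−η₁−1/2}` smooth as `z → 1`, `R̃(z)(z−z₂)^{η₀+η₂−1/2}` smooth as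
`z → z₂`". With `p := z(z−1)(z₂−z)`, `ũ := p^{−1/2} R̃` and `d/dz* = p d/dz` one has `ũ'' + Ṽ ũ = 0`
with `Ṽ` the PRINTED potential (3.27) (`ctdcTildeV` below, transcribed symbol for symbol; the bridge
`Ṽ = −p C̃ + ½ p p″ − ¼ p′²` to (3.25) is exact algebra, pub-kds kit job j166407), and the current
`Q^T[ũ] = Im(conj(ω ũ) ũ')` satisfies `−(Q^T)' = Im ω |ũ'|² + Im(ω̄ Ṽ)|ũ|²` (3.29 bis). The printed
conclusion: "One can verify that unless `|ω|²/m² < Ω_SR²` [(3.30), `Ω_SR = (ϖ₂/κ₂+ϖ₀/κ₀)/(1/κ₂+1/κ₀)`]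
the right hand side of (3.28) is non-negative for `z ∈ [1, z₂]` in the full subextremal range of
parameters. In this case, we deduce directly from (3.29) that `ũ = 0`."

What this file PROVES (every statement a theorem; the "One can verify" is verified):

* `im_conj_mul_ctdcTildeV_eq` — the pointwise identity behind (3.28): with `η_j = (−1)^j i(ω−mϖ_j)/(2κ_j)`
  (the tree's `etaOf`), `w_j := 1/(2κ_j)`,
  `Im(ω̄ Ṽ(z)) = −p·Im(ω̄·LT) + Im ω·(E(z) + p c |ω|² + z·(|ω|² A(z) − m² B(z)))`,
  where `E ≥ 0` is the `(ω,m,λ̄)`-independent part, `LT` the `λ̄`-block, and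
  `A(z) = z S₁(z)² + (z−1)(z₂−z)(4w₁w₂ z − c)`, `B(z) = z S₂(z)² + 4z(z−1)(z₂−z) w₁w₂ϖ₁ϖ₂`,
  `S₁ = w₀(z₂−1) − w₁(z₂−z) + w₂(z−1)`, `S₂ = w₀ϖ₀(z₂−1) − w₁ϖ₁(z₂−z) + w₂ϖ₂(z−1)`
  (`tildeA`, `tildeB`, `tildeS₁`, `tildeS₂`; `c = L²Ξ²a²/((r₁−r₀)(r₂−r₃))` is the coefficient of the
  `a²|ω|²` term the authors keep in (3.28));
* `tildeG_eq_mul_tildeH` — the STRUCTURE of the printed claim: with `Ω` the `κ`-weighted mean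
  `Ω(w₀+w₂) = w₀ϖ₀ + w₂ϖ₂` (= `Ω_SR`), `Ω² A(z) − B(z) = (z₂ − z)·H(z)` identically, and
  `H(z) = h₀ + h₁(z−1) + h₂(z−1)²` with `h₀ = D·F₃·(z₂−1)`, `h₂ = F₁·F₂`, `h₁ = h₀ + h₂ − Ω²c`
  (`tildeH_expand`; `D, F₁, F₂, F₃` explicit affine expressions in the `w_j, ϖ_j, Ω`);
* `kds_tildeD_pos`, `kds_tildeF₁_pos`, `kds_tildeF₂_pos`, `kds_tildeF₃_pos`, `kds_OmegaSq_mul_c_lt`,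
  `kds_c_le`, `kds_tildeRHS_pos` — ON SUBEXTREMAL KERR–DE SITTER (`0 < r₀ < r₁ < r₂`,
  `r₃ = −(r₀+r₁+r₂)`, Vieta `3/Λ − a² = r₀²+r₁²+r₂²+r₀r₁+r₀r₂+r₁r₂` built into `kdsL2`; closed forms
  (3.10) of the `κ_j` from `KerrDeSitterSurfaceGravities.lean`, `inv_two_surfaceGravity_*`):
  `D > 0`, `F₃ > 0`, `F₁ > 0`, `F₂ > 0`, `Ω²c < F₁F₂` and `c ≤ 4w₁w₂` — each reducing, by the
  factorisations `2r_j²+a²−3/Λ+(r₀+r₂)² ∈ {(r₀−r₁)(2r₀+r₁+r₂), −(r₁−r₀)(r₂−r₁), (r₂−r₁)(2r₂+r₀+r₁)}`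
  (closed forms `kds_tildeD_eq`, `kds_tildeF₁_eq`, `kds_tildeF₂_eq`, `kds_tildeF₃_eq`), to a one-line
  inequality in the roots (`kds_key_ineq`: `r₁+r₂ < 2L`; `kds_c_le`: `r₂ < L`);
* `im_conj_mul_ctdcTildeV_pos` — ★ hence `Im(ω̄ Ṽ(z)) > 0` for every `z ∈ (1, z₂)` (ANY `z₂ > 1`)
  whenever `Im ω > 0`, `Im(λ̄ ω̄) ≤ 0` and `|ω| ≥ |m|·Ω_SR` (the tree's `superradiantUpper`): the
  printed "One can verify … non-negative for `z ∈ [1,z₂]` in the full subextremal range", proved,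
  with strictness in the interior;
* `tildeSolution_eq_zero_of_pos` (abstract), `ctdcStep2_eq_zero`, `ctdcStep2_eq_zero_of_normalForm`
  — ★ STEP 2 ITSELF, in boundary-flux form (as the tree renders Step 1 in
  `KerrDeSitterRadialEnergyIdentity.lean`; no `z*` variable, no square roots): for the flux
  `F = Im(ω̄ R̃′ conj R̃) + (Im ω/2)(p′/p)|R̃|²` (`= Q^T[ũ]`) one has
  `F′ = −Im ω |R̃′ − (p′/2p)R̃|² − |R̃|² Im(ω̄ Ṽ)/p² ≤ 0` (`tildeFlux_deriv_im`), `F → 0` at both ends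
  (`tendsto_flux_of_cpowBranch_half`; the (3.26) exponents have `Re(η₀+η₁+½) > ½` by `κ₁ < κ₀`,
  `surfaceGravity_rPlus_lt_rMinus`, and `Re(½−η₀−η₂) > ½`: `re_exponent_one_gt_half`,
  `re_exponent_z₂_gt_half`), so every solution of `p² R̃″ + (Ṽ − ½pp″ + ¼p′²) R̃ = 0` on `(1,z₂)`
  (`IsTildeSolution`) — equivalently of the normal form `z(z−1)(z−z₂)R̃″ + C̃R̃ = 0` for ANY
  coefficient `C̃` with `p C̃ = −Ṽ + ½pp″ − ¼p′²` (`isTildeSolution_of_normalForm`) — obeying (3.26)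
  (`IsTildeBranchAtOne`, `IsTildeBranchAtZ₂`) vanishes identically, for every `z₂ > 1`;
* `ctdcStep2_of_normalFormModeData` (§Assembly) — ★ Step 2 in the shape consumed by the pub-kds
  kernel `Summits/Ventures/KdS/RouteW.lean` (`RouteW.SwappedEnergyVanishing`, `0 ≤ a`): CTdC's
  `z₂ = ctdcZ₂ r₋ r₊ r_c` of (3.14) (`one_lt_ctdcZ₂`: `z₂ > 1`), the (3.25) coefficient
  `C̃ = ctdcTildeCoeff` (`KerrDeSitterHiddenSymmetryKernel.lean`) tied to the printed `Ṽ` by the exact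
  identity `p·C̃ = −Ṽ + ½pp″ − ¼p′²` (`ctdcP_mul_ctdcTildeCoeff`), the (3.26) branches written
  `R̃ = (z−1)^{½+η₀+η₁}·h`, `R̃ = (z₂−z)^{½−η₀−η₂}·g`; the degenerate Schwarzschild–de Sitter case
  `a = 0` (inside the paper's range `|a| < L`: all `ϖ_j = 0`, so the `m²`-part of (3.28) vanishes;
  `r₋ = 0` and the printed (3.10) value is `η₀ = i L²Ξ(ω(r₀²+a²) − am)/|∏_{j'≠0}(r₀−r_{j'})| = 0` —
  `etaCauchy_zero_a`, reached in the tree via the junk value `κ₀ = |Δ′(0)|/(2ξ·0) = 0`) is included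
  (`im_conj_mul_ctdcTildeV_pos_zero_a`, `im_conj_mul_ctdcTildeV_pos'`, `ctdcStep2_eq_zero'`).

What is NOT here: the Euler/hypergeometric transformation producing `R̃` from a Teukolsky mode
(Proposition 3.9 / Corollary 3.10 (i)⇒(iii); the cited fact
`CasalsTeixeiraDaCosta2022_partialModeStabilityProp38` stays cited), Lemma 3.5, and the real-axis
case `Im ω = 0` of Step 2 (Wronskian/unique continuation). Conventions: `(z₂ − z)^{1/2−η₀−η₂}` with the
POSITIVE base `z₂ − z` replaces the printed `(z − z₂)^{…}` (a constant factor, absorbed in the smooth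
function — the tree's convention in `IsOutgoingAtCosmoHorizon`); the `λ̄`-block is
`LT = (3/Λ)(λ̄ − 2Ξ²amω + Ξ²a²ω²)/((r₂−r₃)(r₁−r₀))` with `Ξ²` as in (3.15b)/(3.25) (the held text
prints `Ξ¹` inside (3.27); immaterial here since `Im(ω̄·mω) = 0`).

## References
* [CasalsTeixeiradacosta2022] arXiv:2105.13329 v1: Cor. 3.10 (3.25)–(3.26) p. 16; Thm 3.11 proof,
  Step 2, (3.27)–(3.30) pp. 17–18 (= v3 Cor. 3.9 / Thm 3.10).
-/

noncomputable section

open Complex Set Filter Topology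

open scoped ComplexConjugate

namespace Literature.Geometry.Lorentzian.KerrDeSitter

/-! ### The printed objects: `p`, the `(ω,m,λ̄)`-independent part `E`, and `Ṽ` of (3.27) -/

/-- `p(z) = z(z−1)(z₂−z)` (`dz* = dz/p`). [cite: CasalsTeixeiradacosta2022, Theorem 3.10 (proof, Step 2)] -/
def ctdcP (z₂ z : ℝ) : ℝ := z * (z - 1) * (z₂ - z)

/-- `p′(z) = −3z² + 2(1+z₂)z − z₂`. [cite: CasalsTeixeiradacosta2022, Theorem 3.10 (proof, Step 2)] -/
def ctdcPD (z₂ z : ℝ) : ℝ := -3 * z ^ 2 + 2 * (1 + z₂) * z - z₂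

/-- `p″(z) = −6z + 2(1+z₂)`. [cite: CasalsTeixeiradacosta2022, Theorem 3.10 (proof, Step 2)] -/
def ctdcPDD (z₂ z : ℝ) : ℝ := -6 * z + 2 * (1 + z₂)

/-- The `(ω, m, λ̄)`-independent part of `−Ṽ` in (3.27) (a real polynomial in `z`; `r₃ = −(r₀+r₁+r₂)`):
`E(z) = p(z)(z − ½) + (z−1)(z₂−z)[ s²(r₁+r₂)²/((r₁−r₀)(r₂−r₃))·(z − (r₂−r₀)(r₁−r₃)/(r₁²+2r₂r₁+r₂²))`
`+ z(r₀+r₁)²/(2(r₁−r₀)(r₂−r₃)) ]`. [cite: CasalsTeixeiradacosta2022, (3.27)] -/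
def ctdcTildeE (s z₂ r₀ r₁ r₂ z : ℝ) : ℝ :=
  ctdcP z₂ z * (z - 1 / 2) +
    (z - 1) * (z₂ - z) *
      (s ^ 2 * (r₁ + r₂) ^ 2 / ((r₁ - r₀) * (r₂ + (r₀ + r₁ + r₂))) *
          (z - (r₂ - r₀) * (r₁ + (r₀ + r₁ + r₂)) / (r₁ ^ 2 + 2 * r₂ * r₁ + r₂ ^ 2)) +
        z * (r₀ + r₁) ^ 2 / (2 * (r₁ - r₀) * (r₂ + (r₀ + r₁ + r₂))))

/-- **The transformed potential `Ṽ` of (3.27), as printed** (`LT` = the `λ̄`-block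
`L²(λ̄ + Ξ²a²ω² − 2aΞ²mω)/((r₁−r₀)(r₂−r₃))` kept as one symbol; `η_j` the (3.10) exponents):
`Ṽ = −p·LT − p(z−½) − (z−1)(z₂−z)[…] − z²[η₂²(z−1)² + 2(z₂−1)η₀η₂(z−1) + (z₂−1)²η₀²]`
`− z²[2(z₂−1)η₀η₁(z₂−z) + η₁²(z₂−z)² − 2η₁η₂(z−1)(z₂−z)]`. [cite: CasalsTeixeiradacosta2022, (3.27)] -/
def ctdcTildeV (s : ℝ) (η₀ η₁ η₂ LT : ℂ) (z₂ r₀ r₁ r₂ : ℝ) (z : ℝ) : ℂ :=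
  -(ctdcP z₂ z : ℂ) * LT - (ctdcTildeE s z₂ r₀ r₁ r₂ z : ℂ)
    - (z : ℂ) ^ 2 *
        (η₂ ^ 2 * ((z : ℂ) - 1) ^ 2 + 2 * ((z₂ : ℂ) - 1) * η₀ * η₂ * ((z : ℂ) - 1) +
          ((z₂ : ℂ) - 1) ^ 2 * η₀ ^ 2)
    - (z : ℂ) ^ 2 *
        (2 * ((z₂ : ℂ) - 1) * η₀ * η₁ * ((z₂ : ℂ) - z) + η₁ ^ 2 * ((z₂ : ℂ) - z) ^ 2 -
          2 * η₁ * η₂ * ((z : ℂ) - 1) * ((z₂ : ℂ) - z))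

/-! ### The real quadratic-form data behind (3.28): `S₁, S₂, A, B, D, F₁, F₂, F₃, H` -/

/-- `S₁(z) = w₀(z₂−1) − w₁(z₂−z) + w₂(z−1)` (`w_j = 1/(2κ_j)`). [cite: CasalsTeixeiradacosta2022, (3.28)] -/
def tildeS₁ (w₀ w₁ w₂ z₂ z : ℝ) : ℝ := w₀ * (z₂ - 1) - w₁ * (z₂ - z) + w₂ * (z - 1)

/-- `S₂(z) = w₀ϖ₀(z₂−1) − w₁ϖ₁(z₂−z) + w₂ϖ₂(z−1)`. [cite: CasalsTeixeiradacosta2022, (3.28)] -/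
def tildeS₂ (w₀ w₁ w₂ ϖ₀ ϖ₁ ϖ₂ z₂ z : ℝ) : ℝ :=
  w₀ * ϖ₀ * (z₂ - 1) - w₁ * ϖ₁ * (z₂ - z) + w₂ * ϖ₂ * (z - 1)

/-- `A(z) = z S₁² + (z−1)(z₂−z)(4w₁w₂ z − c)`: the `|ω|²`-coefficient of the right side of (3.28).
[cite: CasalsTeixeiradacosta2022, (3.28)] -/
def tildeA (w₀ w₁ w₂ c z₂ z : ℝ) : ℝ :=
  z * tildeS₁ w₀ w₁ w₂ z₂ z ^ 2 + (z - 1) * (z₂ - z) * (4 * w₁ * w₂ * z - c)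

/-- `B(z) = z S₂² + 4z(z−1)(z₂−z)w₁w₂ϖ₁ϖ₂`: minus the `m²`-coefficient of the right side of (3.28).
[cite: CasalsTeixeiradacosta2022, (3.28)] -/
def tildeB (w₀ w₁ w₂ ϖ₀ ϖ₁ ϖ₂ z₂ z : ℝ) : ℝ :=
  z * tildeS₂ w₀ w₁ w₂ ϖ₀ ϖ₁ ϖ₂ z₂ z ^ 2 + 4 * z * (z - 1) * (z₂ - z) * w₁ * w₂ * ϖ₁ * ϖ₂

/-- `D = w₁(Ω−ϖ₁) + w₂(Ω−ϖ₂)`. [cite: CasalsTeixeiradacosta2022, (3.28)] -/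
def tildeD (w₁ w₂ ϖ₁ ϖ₂ Ω : ℝ) : ℝ := w₁ * (Ω - ϖ₁) + w₂ * (Ω - ϖ₂)

/-- `F₁ = w₁(ϖ₁−Ω) + w₂(Ω−ϖ₂)`. [cite: CasalsTeixeiradacosta2022, (3.28)] -/
def tildeF₁ (w₁ w₂ ϖ₁ ϖ₂ Ω : ℝ) : ℝ := w₁ * (ϖ₁ - Ω) + w₂ * (Ω - ϖ₂)

/-- `F₂ = w₁(ϖ₁+Ω) − w₂(ϖ₂+Ω)`. [cite: CasalsTeixeiradacosta2022, (3.28)] -/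
def tildeF₂ (w₁ w₂ ϖ₁ ϖ₂ Ω : ℝ) : ℝ := w₁ * (ϖ₁ + Ω) - w₂ * (ϖ₂ + Ω)

/-- `F₃ = w₁(Ω+ϖ₁) − w₀(Ω+ϖ₀)`. [cite: CasalsTeixeiradacosta2022, (3.28)] -/
def tildeF₃ (w₀ w₁ ϖ₀ ϖ₁ Ω : ℝ) : ℝ := w₁ * (Ω + ϖ₁) - w₀ * (Ω + ϖ₀)

/-- `H(z) = −z D (Ω S₁ + S₂) + (z−1)(4w₁w₂ z(Ω² − ϖ₁ϖ₂) − Ω²c)`, the cofactor in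
`Ω²A − B = (z₂ − z)H`. [cite: CasalsTeixeiradacosta2022, (3.28)] -/
def tildeH (w₀ w₁ w₂ ϖ₀ ϖ₁ ϖ₂ Ω c z₂ z : ℝ) : ℝ :=
  -z * tildeD w₁ w₂ ϖ₁ ϖ₂ Ω * (Ω * tildeS₁ w₀ w₁ w₂ z₂ z + tildeS₂ w₀ w₁ w₂ ϖ₀ ϖ₁ ϖ₂ z₂ z) +
    (z - 1) * (4 * w₁ * w₂ * z * (Ω ^ 2 - ϖ₁ * ϖ₂) - Ω ^ 2 * c)

/-- **`Ω²A(z) − B(z) = (z₂ − z)·H(z)`** identically in `z`, as soon as `Ω` is the weighted mean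
`Ω(w₀+w₂) = w₀ϖ₀ + w₂ϖ₂` (this is where `Ω = Ω_SR` enters: `ΩS₁ − S₂` vanishes at `z = z₂`).
[cite: CasalsTeixeiradacosta2022, Theorem 3.10 (proof, Step 2)] -/
theorem tildeG_eq_mul_tildeH {w₀ w₁ w₂ ϖ₀ ϖ₁ ϖ₂ Ω : ℝ} (hΩ : Ω * (w₀ + w₂) = w₀ * ϖ₀ + w₂ * ϖ₂)
    (c z₂ z : ℝ) :
    Ω ^ 2 * tildeA w₀ w₁ w₂ c z₂ z - tildeB w₀ w₁ w₂ ϖ₀ ϖ₁ ϖ₂ z₂ z =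
      (z₂ - z) * tildeH w₀ w₁ w₂ ϖ₀ ϖ₁ ϖ₂ Ω c z₂ z := by
  unfold tildeA tildeB tildeH tildeD tildeS₁ tildeS₂
  linear_combination (z * (z₂ - 1) *
    (Ω * (w₀ * (z₂ - 1) - w₁ * (z₂ - z) + w₂ * (z - 1)) +
      (w₀ * ϖ₀ * (z₂ - 1) - w₁ * ϖ₁ * (z₂ - z) + w₂ * ϖ₂ * (z - 1)))) * hΩ

/-- **`H` is a quadratic in `z − 1`**: `H(z) = h₀ + h₁(z−1) + h₂(z−1)²` with `h₀ = D F₃ (z₂−1)`,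
`h₂ = F₁F₂`, `h₁ = h₀ + h₂ − Ω²c`. [cite: CasalsTeixeiradacosta2022, Theorem 3.10 (proof, Step 2)] -/
theorem tildeH_expand (w₀ w₁ w₂ ϖ₀ ϖ₁ ϖ₂ Ω c z₂ z : ℝ) :
    tildeH w₀ w₁ w₂ ϖ₀ ϖ₁ ϖ₂ Ω c z₂ z =
      tildeD w₁ w₂ ϖ₁ ϖ₂ Ω * tildeF₃ w₀ w₁ ϖ₀ ϖ₁ Ω * (z₂ - 1) +
        (tildeD w₁ w₂ ϖ₁ ϖ₂ Ω * tildeF₃ w₀ w₁ ϖ₀ ϖ₁ Ω * (z₂ - 1) +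
            tildeF₁ w₁ w₂ ϖ₁ ϖ₂ Ω * tildeF₂ w₁ w₂ ϖ₁ ϖ₂ Ω - Ω ^ 2 * c) * (z - 1) +
          tildeF₁ w₁ w₂ ϖ₁ ϖ₂ Ω * tildeF₂ w₁ w₂ ϖ₁ ϖ₂ Ω * (z - 1) ^ 2 := by
  unfold tildeH tildeD tildeF₁ tildeF₂ tildeF₃ tildeS₁ tildeS₂
  ring

/-- **Positivity of `H` on `[1, ∞)`** from the signs of its three coefficients: `D > 0`, `F₃ > 0`,
`F₁ ≥ 0`, `F₂ ≥ 0`, `Ω²c ≤ F₁F₂` and `z₂ > 1` give `H(z) ≥ h₀ > 0` for `z ≥ 1`.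
[cite: CasalsTeixeiradacosta2022, Theorem 3.10 (proof, Step 2)] -/
theorem tildeH_pos {w₀ w₁ w₂ ϖ₀ ϖ₁ ϖ₂ Ω c z₂ : ℝ} (hz₂ : 1 < z₂)
    (hD : 0 < tildeD w₁ w₂ ϖ₁ ϖ₂ Ω) (hF₃ : 0 < tildeF₃ w₀ w₁ ϖ₀ ϖ₁ Ω)
    (hF₁ : 0 ≤ tildeF₁ w₁ w₂ ϖ₁ ϖ₂ Ω) (hF₂ : 0 ≤ tildeF₂ w₁ w₂ ϖ₁ ϖ₂ Ω)
    (hc : Ω ^ 2 * c ≤ tildeF₁ w₁ w₂ ϖ₁ ϖ₂ Ω * tildeF₂ w₁ w₂ ϖ₁ ϖ₂ Ω) {z : ℝ} (hz : 1 ≤ z) :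
    0 < tildeH w₀ w₁ w₂ ϖ₀ ϖ₁ ϖ₂ Ω c z₂ z := by
  rw [tildeH_expand]
  set d := tildeD w₁ w₂ ϖ₁ ϖ₂ Ω
  set f₃ := tildeF₃ w₀ w₁ ϖ₀ ϖ₁ Ω
  set f₁ := tildeF₁ w₁ w₂ ϖ₁ ϖ₂ Ω
  set f₂ := tildeF₂ w₁ w₂ ϖ₁ ϖ₂ Ω
  have h0 : 0 < d * f₃ * (z₂ - 1) := mul_pos (mul_pos hD hF₃) (by linarith)
  have h2 : 0 ≤ f₁ * f₂ := mul_nonneg hF₁ hF₂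
  have hu : 0 ≤ z - 1 := by linarith
  have h1 : 0 ≤ d * f₃ * (z₂ - 1) + f₁ * f₂ - Ω ^ 2 * c := by linarith
  have t1 : 0 ≤ (d * f₃ * (z₂ - 1) + f₁ * f₂ - Ω ^ 2 * c) * (z - 1) := mul_nonneg h1 hu
  have t2 : 0 ≤ f₁ * f₂ * (z - 1) ^ 2 := mul_nonneg h2 (sq_nonneg _)
  linarith

/-- **Positivity of `A` on `(1, z₂)`**: `A(z) = zS₁² + (z−1)(z₂−z)(4w₁w₂z − c) > 0` when
`0 < w₁w₂` and `c ≤ 4w₁w₂`. [cite: CasalsTeixeiradacosta2022, Theorem 3.10 (proof, Step 2)] -/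
theorem tildeA_pos {w₀ w₁ w₂ c z₂ : ℝ} (hw : 0 < w₁ * w₂) (hc : c ≤ 4 * w₁ * w₂) {z : ℝ}
    (hz : z ∈ Ioo 1 z₂) : 0 < tildeA w₀ w₁ w₂ c z₂ z := by
  unfold tildeA
  have h1 : 0 < z - 1 := by linarith [hz.1]
  have h2 : 0 < z₂ - z := by linarith [hz.2]
  have h3 : 0 < 4 * w₁ * w₂ * z - c := by nlinarith [hz.1]
  have h4 : 0 ≤ z * tildeS₁ w₀ w₁ w₂ z₂ z ^ 2 := mul_nonneg (by linarith [hz.1]) (sq_nonneg _)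
  have h5 : 0 < (z - 1) * (z₂ - z) * (4 * w₁ * w₂ * z - c) := mul_pos (mul_pos h1 h2) h3
  linarith

/-- **The right side of (3.28) is positive in the interior** when `|ω|² ≥ m²Ω²`:
`W·A(z) − μ·B(z) = (W − μΩ²)A(z) + μ(z₂−z)H(z) > 0` for `z ∈ (1,z₂)`, `W > 0`, `μ ≥ 0`, `μΩ² ≤ W`.
[cite: CasalsTeixeiradacosta2022, Theorem 3.10 (proof, Step 2), (3.28)–(3.30)] -/
theorem tildeRHS_pos {w₀ w₁ w₂ ϖ₀ ϖ₁ ϖ₂ Ω c z₂ W μ : ℝ} (hz₂ : 1 < z₂)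
    (hΩ : Ω * (w₀ + w₂) = w₀ * ϖ₀ + w₂ * ϖ₂)
    (hD : 0 < tildeD w₁ w₂ ϖ₁ ϖ₂ Ω) (hF₃ : 0 < tildeF₃ w₀ w₁ ϖ₀ ϖ₁ Ω)
    (hF₁ : 0 ≤ tildeF₁ w₁ w₂ ϖ₁ ϖ₂ Ω) (hF₂ : 0 ≤ tildeF₂ w₁ w₂ ϖ₁ ϖ₂ Ω)
    (hcF : Ω ^ 2 * c ≤ tildeF₁ w₁ w₂ ϖ₁ ϖ₂ Ω * tildeF₂ w₁ w₂ ϖ₁ ϖ₂ Ω)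
    (hw : 0 < w₁ * w₂) (hc : c ≤ 4 * w₁ * w₂)
    (hW : 0 < W) (hμ : 0 ≤ μ) (hWμ : μ * Ω ^ 2 ≤ W) {z : ℝ} (hz : z ∈ Ioo 1 z₂) :
    0 < W * tildeA w₀ w₁ w₂ c z₂ z - μ * tildeB w₀ w₁ w₂ ϖ₀ ϖ₁ ϖ₂ z₂ z := by
  have hA := tildeA_pos (w₀ := w₀) (z₂ := z₂) hw hc hz
  have hH := tildeH_pos (w₀ := w₀) (ϖ₀ := ϖ₀) (c := c) hz₂ hD hF₃ hF₁ hF₂ hcF (le_of_lt hz.1)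
  have hG := tildeG_eq_mul_tildeH (w₁ := w₁) (ϖ₁ := ϖ₁) hΩ c z₂ z
  have hz2 : 0 < z₂ - z := by linarith [hz.2]
  -- `W A − μ B = (W − μΩ²) A + μ (Ω²A − B)`
  have e : W * tildeA w₀ w₁ w₂ c z₂ z - μ * tildeB w₀ w₁ w₂ ϖ₀ ϖ₁ ϖ₂ z₂ z =
      (W - μ * Ω ^ 2) * tildeA w₀ w₁ w₂ c z₂ z +
        μ * ((z₂ - z) * tildeH w₀ w₁ w₂ ϖ₀ ϖ₁ ϖ₂ Ω c z₂ z) := by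
    rw [← hG]; ring
  rw [e]
  rcases eq_or_lt_of_le hμ with hμ0 | hμpos
  · rw [← hμ0]
    simp only [zero_mul, sub_zero, add_zero]
    exact mul_pos hW hA
  · have t1 : 0 ≤ (W - μ * Ω ^ 2) * tildeA w₀ w₁ w₂ c z₂ z :=
      mul_nonneg (by linarith) hA.le
    have t2 : 0 < μ * ((z₂ - z) * tildeH w₀ w₁ w₂ ϖ₀ ϖ₁ ϖ₂ Ω c z₂ z) :=
      mul_pos hμpos (mul_pos hz2 hH)
    linarith

/-! ### From the printed `Ṽ` to the quadratic-form data: the complex algebra -/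

/-- `(3.27)` with `η_j = I·e_j`: the two `η`-lines of `Ṽ` become `+z²·Q(e)` with
`Q = (e₂(z−1) + e₀(z₂−1))² + 2(z₂−1)(z₂−z)e₀e₁ + (z₂−z)²e₁² − 2(z−1)(z₂−z)e₁e₂` (uses `I² = −1`).
[cite: CasalsTeixeiradacosta2022, (3.27)] -/
theorem ctdcTildeV_eq_of_I_mul (s : ℝ) (e₀ e₁ e₂ LT : ℂ) (z₂ r₀ r₁ r₂ z : ℝ) :
    ctdcTildeV s (I * e₀) (I * e₁) (I * e₂) LT z₂ r₀ r₁ r₂ z =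
      -(ctdcP z₂ z : ℂ) * LT - (ctdcTildeE s z₂ r₀ r₁ r₂ z : ℂ) +
        (z : ℂ) ^ 2 *
          ((e₂ * ((z : ℂ) - 1) + e₀ * ((z₂ : ℂ) - 1)) ^ 2 +
            2 * ((z₂ : ℂ) - 1) * ((z₂ : ℂ) - z) * e₀ * e₁ + ((z₂ : ℂ) - z) ^ 2 * e₁ ^ 2 -
            2 * ((z : ℂ) - 1) * ((z₂ : ℂ) - z) * e₁ * e₂) := by
  unfold ctdcTildeV
  linear_combination (-(z : ℂ) ^ 2 *
    ((e₂ * ((z : ℂ) - 1) + e₀ * ((z₂ : ℂ) - 1)) ^ 2 +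
      2 * ((z₂ : ℂ) - 1) * ((z₂ : ℂ) - z) * e₀ * e₁ + ((z₂ : ℂ) - z) ^ 2 * e₁ ^ 2 -
      2 * ((z : ℂ) - 1) * ((z₂ : ℂ) - z) * e₁ * e₂)) * Complex.I_sq

/-- The (3.10) exponent as `I` times a real multiple of `ω − mϖ`: `η = I·(σ/(2κ))·(ω − mϖ)`.
[cite: CasalsTeixeiradacosta2022, (3.10)] -/
theorem etaOf_eq_I_mul (σ ϖ κ : ℝ) (ω : ℂ) (m : ℝ) :
    etaOf σ ϖ κ ω m = I * (((σ * (1 / (2 * κ)) : ℝ) : ℂ) * (ω - ((m * ϖ : ℝ) : ℂ))) := by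
  unfold etaOf
  push_cast
  rw [div_eq_mul_inv]
  ring

/-- **(3.27) in quadratic-form shape.** With `η₀ = I w₀(ω−mϖ₀)`, `η₁ = −I w₁(ω−mϖ₁)`,
`η₂ = I w₂(ω−mϖ₂)` (`w_j = 1/(2κ_j)`, signs `(−1)^j`):
`Ṽ = −p·LT − E + z²(ωS₁ − mS₂)² + 4z²(z−1)(z₂−z)w₁w₂(ω−mϖ₁)(ω−mϖ₂)`.
[cite: CasalsTeixeiradacosta2022, (3.27)–(3.28)] -/
theorem ctdcTildeV_eq_quadratic (s : ℝ) (w₀ w₁ w₂ ϖ₀ ϖ₁ ϖ₂ : ℝ) (ω LT : ℂ) (m : ℝ)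
    (z₂ r₀ r₁ r₂ z : ℝ) :
    ctdcTildeV s (I * ((w₀ : ℂ) * (ω - ((m * ϖ₀ : ℝ) : ℂ))))
        (I * (-(w₁ : ℂ) * (ω - ((m * ϖ₁ : ℝ) : ℂ)))) (I * ((w₂ : ℂ) * (ω - ((m * ϖ₂ : ℝ) : ℂ))))
        LT z₂ r₀ r₁ r₂ z =
      -(ctdcP z₂ z : ℂ) * LT - (ctdcTildeE s z₂ r₀ r₁ r₂ z : ℂ) +
        (z : ℂ) ^ 2 * (ω * (tildeS₁ w₀ w₁ w₂ z₂ z : ℂ) -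
            (m : ℂ) * (tildeS₂ w₀ w₁ w₂ ϖ₀ ϖ₁ ϖ₂ z₂ z : ℂ)) ^ 2 +
        4 * (z : ℂ) ^ 2 * ((z : ℂ) - 1) * ((z₂ : ℂ) - z) * (w₁ : ℂ) * (w₂ : ℂ) *
          ((ω - ((m * ϖ₁ : ℝ) : ℂ)) * (ω - ((m * ϖ₂ : ℝ) : ℂ))) := by
  rw [ctdcTildeV_eq_of_I_mul]
  unfold tildeS₁ tildeS₂
  push_cast
  ring

/-- `Im(c̄ (c S − m T)²) = Im c · (S²|c|² − m²T²)` for real `S, T, m` (pure algebra).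
[cite: CasalsTeixeiradacosta2022, Theorem 3.10 (proof, Step 2)] -/
theorem im_conj_mul_sq_sub (c : ℂ) (S T m : ℝ) :
    (conj c * (c * (S : ℂ) - (m : ℂ) * (T : ℂ)) ^ 2).im = c.im * (S ^ 2 * normSq c - m ^ 2 * T ^ 2) := by
  simp only [pow_two, mul_im, mul_re, sub_im, sub_re, ofReal_re, ofReal_im, conj_re, conj_im,
    normSq_apply]
  ring

/-- `Im(c̄ (c − u)(c − v)) = Im c · (|c|² − uv)` for real `u, v` (pure algebra).
[cite: CasalsTeixeiradacosta2022, Theorem 3.10 (proof, Step 2)] -/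
theorem im_conj_mul_lin_lin (c : ℂ) (u v : ℝ) :
    (conj c * ((c - (u : ℂ)) * (c - (v : ℂ)))).im = c.im * (normSq c - u * v) := by
  simp only [mul_im, mul_re, sub_im, sub_re, ofReal_re, ofReal_im, conj_re, conj_im, normSq_apply]
  ring

/-- `Im(c̄ · r) = −r · Im c` for real `r` (pure algebra). [cite: CasalsTeixeiradacosta2022, Theorem 3.10 (proof, Step 2)] -/
theorem im_conj_mul_ofReal' (c : ℂ) (r : ℝ) : (conj c * (r : ℂ)).im = -(r * c.im) := by
  simp only [mul_im, ofReal_re, ofReal_im, conj_re, conj_im]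
  ring

/-- **The integrand of (3.29) bis, pointwise** — the identity behind (3.28): with the `η_j` in
quadratic-form shape,
`Im(ω̄ Ṽ(z)) = −p·Im(ω̄·LT) + Im ω·( E(z) + p·c·|ω|² + z·(|ω|²·A(z) − m²·B(z)) )`.
[cite: CasalsTeixeiradacosta2022, Theorem 3.10 (proof, Step 2), (3.28)] -/
theorem im_conj_mul_ctdcTildeV_eq (s : ℝ) (w₀ w₁ w₂ ϖ₀ ϖ₁ ϖ₂ c : ℝ) (ω LT : ℂ) (m : ℝ)
    (z₂ r₀ r₁ r₂ z : ℝ) :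
    (conj ω * ctdcTildeV s (I * ((w₀ : ℂ) * (ω - ((m * ϖ₀ : ℝ) : ℂ))))
        (I * (-(w₁ : ℂ) * (ω - ((m * ϖ₁ : ℝ) : ℂ)))) (I * ((w₂ : ℂ) * (ω - ((m * ϖ₂ : ℝ) : ℂ))))
        LT z₂ r₀ r₁ r₂ z).im =
      -(ctdcP z₂ z * (conj ω * LT).im) +
        ω.im * (ctdcTildeE s z₂ r₀ r₁ r₂ z + ctdcP z₂ z * c * normSq ω +
          z * (normSq ω * tildeA w₀ w₁ w₂ c z₂ z - m ^ 2 * tildeB w₀ w₁ w₂ ϖ₀ ϖ₁ ϖ₂ z₂ z)) := by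
  rw [ctdcTildeV_eq_quadratic]
  have e : conj ω * (-(ctdcP z₂ z : ℂ) * LT - (ctdcTildeE s z₂ r₀ r₁ r₂ z : ℂ) +
        (z : ℂ) ^ 2 * (ω * (tildeS₁ w₀ w₁ w₂ z₂ z : ℂ) -
            (m : ℂ) * (tildeS₂ w₀ w₁ w₂ ϖ₀ ϖ₁ ϖ₂ z₂ z : ℂ)) ^ 2 +
        4 * (z : ℂ) ^ 2 * ((z : ℂ) - 1) * ((z₂ : ℂ) - z) * (w₁ : ℂ) * (w₂ : ℂ) *
          ((ω - ((m * ϖ₁ : ℝ) : ℂ)) * (ω - ((m * ϖ₂ : ℝ) : ℂ)))) =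
      -((ctdcP z₂ z : ℝ) : ℂ) * (conj ω * LT) - conj ω * ((ctdcTildeE s z₂ r₀ r₁ r₂ z : ℝ) : ℂ) +
        ((z ^ 2 : ℝ) : ℂ) * (conj ω * (ω * (tildeS₁ w₀ w₁ w₂ z₂ z : ℂ) -
            (m : ℂ) * (tildeS₂ w₀ w₁ w₂ ϖ₀ ϖ₁ ϖ₂ z₂ z : ℂ)) ^ 2) +
        ((4 * z ^ 2 * (z - 1) * (z₂ - z) * w₁ * w₂ : ℝ) : ℂ) *
          (conj ω * ((ω - ((m * ϖ₁ : ℝ) : ℂ)) * (ω - ((m * ϖ₂ : ℝ) : ℂ)))) := by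
    push_cast; ring
  rw [e]
  simp only [add_im, sub_im, neg_mul, neg_im, im_ofReal_mul, im_conj_mul_sq_sub,
    im_conj_mul_lin_lin, im_conj_mul_ofReal']
  unfold tildeA tildeB ctdcP
  ring

/-- The constant `(r₂−r₀)(r₁−r₃)/(r₁+r₂)²` of (3.27) is `< 1`:
`(r₁+r₂)² − (r₂−r₀)(r₁−r₃) = (r₀+r₁)²` (`r₃ = −(r₀+r₁+r₂)`). [cite: CasalsTeixeiradacosta2022, (3.27)] -/
theorem ctdc_const_identity (r₀ r₁ r₂ : ℝ) :
    (r₁ + r₂) ^ 2 - (r₂ - r₀) * (r₁ + (r₀ + r₁ + r₂)) = (r₀ + r₁) ^ 2 := by ring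

/-- **`E(z) ≥ 0` on `[1, z₂]`** for `0 ≤ r₀ < r₁ < r₂` ("the `(ω,m,λ̄)`-independent part of (3.27) is
non-positive", v1 p. 17 — together with `z − ½ > 0` and `(r₂−r₀)(r₁−r₃)/(r₁+r₂)² < 1 ≤ z`).
[cite: CasalsTeixeiradacosta2022, Theorem 3.10 (proof, Step 2)] -/
theorem ctdcTildeE_nonneg {s z₂ r₀ r₁ r₂ z : ℝ} (h0 : 0 ≤ r₀) (h01 : r₀ < r₁) (h12 : r₁ < r₂)
    (hz : z ∈ Icc 1 z₂) : 0 ≤ ctdcTildeE s z₂ r₀ r₁ r₂ z := by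
  unfold ctdcTildeE ctdcP
  have hz1 : 0 ≤ z - 1 := by linarith [hz.1]
  have hz2 : 0 ≤ z₂ - z := by linarith [hz.2]
  have hzp : 0 < z := by linarith [hz.1]
  have hA : 0 < r₁ - r₀ := by linarith
  have hB : 0 < r₂ + (r₀ + r₁ + r₂) := by linarith
  have hS : 0 < r₁ ^ 2 + 2 * r₂ * r₁ + r₂ ^ 2 := by nlinarith
  have hlt : (r₂ - r₀) * (r₁ + (r₀ + r₁ + r₂)) / (r₁ ^ 2 + 2 * r₂ * r₁ + r₂ ^ 2) ≤ 1 := by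
    rw [div_le_one hS]
    nlinarith [ctdc_const_identity r₀ r₁ r₂, sq_nonneg (r₀ + r₁)]
  have t1 : 0 ≤ z * (z - 1) * (z₂ - z) * (z - 1 / 2) :=
    mul_nonneg (mul_nonneg (mul_nonneg hzp.le hz1) hz2) (by linarith [hz.1])
  have t2 : 0 ≤ s ^ 2 * (r₁ + r₂) ^ 2 / ((r₁ - r₀) * (r₂ + (r₀ + r₁ + r₂))) *
      (z - (r₂ - r₀) * (r₁ + (r₀ + r₁ + r₂)) / (r₁ ^ 2 + 2 * r₂ * r₁ + r₂ ^ 2)) :=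
    mul_nonneg (div_nonneg (by positivity) (mul_pos hA hB).le) (by linarith [hz.1])
  have t3 : 0 ≤ z * (r₀ + r₁) ^ 2 / (2 * (r₁ - r₀) * (r₂ + (r₀ + r₁ + r₂))) :=
    div_nonneg (by positivity) (by positivity)
  have t4 : 0 ≤ (z - 1) * (z₂ - z) *
      (s ^ 2 * (r₁ + r₂) ^ 2 / ((r₁ - r₀) * (r₂ + (r₀ + r₁ + r₂))) *
          (z - (r₂ - r₀) * (r₁ + (r₀ + r₁ + r₂)) / (r₁ ^ 2 + 2 * r₂ * r₁ + r₂ ^ 2)) +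
        z * (r₀ + r₁) ^ 2 / (2 * (r₁ - r₀) * (r₂ + (r₀ + r₁ + r₂)))) :=
    mul_nonneg (mul_nonneg hz1 hz2) (add_nonneg t2 t3)
  linarith

/-! ### The Kerr–de Sitter data in root coordinates (Vieta built in: `3/Λ = a² + Σ`) -/

/-- `L² = 3/Λ` expressed through the roots by the `r²`-Vieta relation:
`3/Λ = a² + (r₀²+r₁²+r₂²+r₀r₁+r₀r₂+r₁r₂)` (`vieta_sq`). [cite: CasalsTeixeiradacosta2022, (3.2)] -/
def kdsL2 (r₀ r₁ r₂ a : ℝ) : ℝ :=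
  a ^ 2 + (r₀ ^ 2 + r₁ ^ 2 + r₂ ^ 2 + r₀ * r₁ + r₀ * r₂ + r₁ * r₂)

/-- `ℓ = L²Ξ = L² + a² = 3Ξ/Λ`. [cite: CasalsTeixeiradacosta2022, (3.10)] -/
def kdsEll (r₀ r₁ r₂ a : ℝ) : ℝ := kdsL2 r₀ r₁ r₂ a + a ^ 2

/-- `N = L²Ξ − (r₀+r₂)²`, the denominator of `Ω_SR = 2a/N`. [cite: CasalsTeixeiradacosta2022, Theorem 2] -/
def kdsN (r₀ r₁ r₂ a : ℝ) : ℝ := kdsEll r₀ r₁ r₂ a - (r₀ + r₂) ^ 2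

/-- `|∏_{j'≠0}(r₀−r_{j'})| = (r₁−r₀)(r₂−r₀)(2r₀+r₁+r₂)`. [cite: CasalsTeixeiradacosta2022, (3.10)] -/
def kdsPi₀ (r₀ r₁ r₂ : ℝ) : ℝ := (r₁ - r₀) * (r₂ - r₀) * (2 * r₀ + r₁ + r₂)

/-- `|∏_{j'≠1}(r₁−r_{j'})| = (r₁−r₀)(r₂−r₁)(r₀+2r₁+r₂)`. [cite: CasalsTeixeiradacosta2022, (3.10)] -/
def kdsPi₁ (r₀ r₁ r₂ : ℝ) : ℝ := (r₁ - r₀) * (r₂ - r₁) * (r₀ + 2 * r₁ + r₂)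

/-- `|∏_{j'≠2}(r₂−r_{j'})| = (r₂−r₀)(r₂−r₁)(r₀+r₁+2r₂)`. [cite: CasalsTeixeiradacosta2022, (3.10)] -/
def kdsPi₂ (r₀ r₁ r₂ : ℝ) : ℝ := (r₂ - r₀) * (r₂ - r₁) * (r₀ + r₁ + 2 * r₂)

/-- `w₀ = 1/(2κ₀) = ℓ(r₀²+a²)/Π₀`. [cite: CasalsTeixeiradacosta2022, (3.10)] -/
def kdsW₀ (r₀ r₁ r₂ a : ℝ) : ℝ := kdsEll r₀ r₁ r₂ a * (r₀ ^ 2 + a ^ 2) / kdsPi₀ r₀ r₁ r₂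

/-- `w₁ = 1/(2κ₁) = ℓ(r₁²+a²)/Π₁`. [cite: CasalsTeixeiradacosta2022, (3.10)] -/
def kdsW₁ (r₀ r₁ r₂ a : ℝ) : ℝ := kdsEll r₀ r₁ r₂ a * (r₁ ^ 2 + a ^ 2) / kdsPi₁ r₀ r₁ r₂

/-- `w₂ = 1/(2κ₂) = ℓ(r₂²+a²)/Π₂`. [cite: CasalsTeixeiradacosta2022, (3.10)] -/
def kdsW₂ (r₀ r₁ r₂ a : ℝ) : ℝ := kdsEll r₀ r₁ r₂ a * (r₂ ^ 2 + a ^ 2) / kdsPi₂ r₀ r₁ r₂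

/-- `Ω_SR = 2a/N` in root coordinates. [cite: CasalsTeixeiradacosta2022, Theorem 2] -/
def kdsOmega (r₀ r₁ r₂ a : ℝ) : ℝ := 2 * a / kdsN r₀ r₁ r₂ a

/-- `c = L²Ξ²a²/((r₁−r₀)(r₂−r₃)) = ℓ²a²/(L²(r₁−r₀)(r₀+r₁+2r₂))`, the coefficient of the `a²|ω|²`
term kept in (3.28). [cite: CasalsTeixeiradacosta2022, (3.28)] -/
def kdsC (r₀ r₁ r₂ a : ℝ) : ℝ :=
  kdsEll r₀ r₁ r₂ a ^ 2 * a ^ 2 / (kdsL2 r₀ r₁ r₂ a * ((r₁ - r₀) * (r₀ + r₁ + 2 * r₂)))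

section RootCoordinates

variable {r₀ r₁ r₂ a : ℝ}

/-- `N = 2a² + r₁² + r₀r₁ + r₂(r₁ − r₀)` (hence `N > 0`). [cite: CasalsTeixeiradacosta2022, Theorem 2] -/
theorem kdsN_eq (r₀ r₁ r₂ a : ℝ) :
    kdsN r₀ r₁ r₂ a = 2 * a ^ 2 + r₁ ^ 2 + r₀ * r₁ + r₂ * (r₁ - r₀) := by
  unfold kdsN kdsEll kdsL2; ring

/-- `N > 0`. [cite: CasalsTeixeiradacosta2022, Theorem 2] -/
theorem kdsN_pos (h0 : 0 ≤ r₀) (h01 : r₀ < r₁) (h12 : r₁ < r₂) : 0 < kdsN r₀ r₁ r₂ a := by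
  rw [kdsN_eq]
  have h1 : 0 ≤ r₀ * r₁ := mul_nonneg h0 (by linarith)
  have h2 : 0 < r₂ * (r₁ - r₀) := mul_pos (by linarith) (by linarith)
  nlinarith [sq_nonneg a]

/-- `L² > 0`. [cite: CasalsTeixeiradacosta2022, (3.2)] -/
theorem kdsL2_pos (h0 : 0 ≤ r₀) (h01 : r₀ < r₁) (h12 : r₁ < r₂) : 0 < kdsL2 r₀ r₁ r₂ a := by
  unfold kdsL2
  have : 0 < r₁ := lt_of_le_of_lt h0 h01
  have h1 : 0 ≤ r₀ * r₁ := by positivity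
  have h2 : 0 ≤ r₀ * r₂ := mul_nonneg h0 (by linarith)
  have h3 : 0 < r₁ * r₂ := mul_pos this (by linarith)
  positivity

/-- `ℓ > 0`. [cite: CasalsTeixeiradacosta2022, (3.10)] -/
theorem kdsEll_pos (h0 : 0 ≤ r₀) (h01 : r₀ < r₁) (h12 : r₁ < r₂) : 0 < kdsEll r₀ r₁ r₂ a := by
  unfold kdsEll; have := kdsL2_pos (a := a) h0 h01 h12; positivity

/-- `Π₀ > 0`. [cite: CasalsTeixeiradacosta2022, (3.10)] -/
theorem kdsPi₀_pos (h0 : 0 ≤ r₀) (h01 : r₀ < r₁) (h12 : r₁ < r₂) : 0 < kdsPi₀ r₀ r₁ r₂ := by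
  unfold kdsPi₀; exact mul_pos (mul_pos (by linarith) (by linarith)) (by linarith)

/-- `Π₁ > 0`. [cite: CasalsTeixeiradacosta2022, (3.10)] -/
theorem kdsPi₁_pos (h0 : 0 ≤ r₀) (h01 : r₀ < r₁) (h12 : r₁ < r₂) : 0 < kdsPi₁ r₀ r₁ r₂ := by
  unfold kdsPi₁; exact mul_pos (mul_pos (by linarith) (by linarith)) (by linarith)

/-- `Π₂ > 0`. [cite: CasalsTeixeiradacosta2022, (3.10)] -/
theorem kdsPi₂_pos (h0 : 0 ≤ r₀) (h01 : r₀ < r₁) (h12 : r₁ < r₂) : 0 < kdsPi₂ r₀ r₁ r₂ := by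
  unfold kdsPi₂; exact mul_pos (mul_pos (by linarith) (by linarith)) (by linarith)

/-- `w₀ > 0`. [cite: CasalsTeixeiradacosta2022, (3.10)] -/
theorem kdsW₀_pos (h0 : 0 ≤ r₀) (h01 : r₀ < r₁) (h12 : r₁ < r₂) (ha : 0 < a) :
    0 < kdsW₀ r₀ r₁ r₂ a := by
  unfold kdsW₀
  exact div_pos (mul_pos (kdsEll_pos h0 h01 h12) (by positivity)) (kdsPi₀_pos h0 h01 h12)

/-- `w₁ > 0`. [cite: CasalsTeixeiradacosta2022, (3.10)] -/
theorem kdsW₁_pos (h0 : 0 ≤ r₀) (h01 : r₀ < r₁) (h12 : r₁ < r₂) (ha : 0 < a) :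
    0 < kdsW₁ r₀ r₁ r₂ a := by
  unfold kdsW₁
  exact div_pos (mul_pos (kdsEll_pos h0 h01 h12) (by positivity)) (kdsPi₁_pos h0 h01 h12)

/-- `w₂ > 0`. [cite: CasalsTeixeiradacosta2022, (3.10)] -/
theorem kdsW₂_pos (h0 : 0 ≤ r₀) (h01 : r₀ < r₁) (h12 : r₁ < r₂) (ha : 0 < a) :
    0 < kdsW₂ r₀ r₁ r₂ a := by
  unfold kdsW₂
  exact div_pos (mul_pos (kdsEll_pos h0 h01 h12) (by positivity)) (kdsPi₂_pos h0 h01 h12)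

/-- **`Ω_SR` is the `κ`-weighted mean of `ϖ₀, ϖ₂`**: `Ω(w₀+w₂) = w₀ϖ₀ + w₂ϖ₂` (the first closing
identity of the printed proof; the tree's `superradiantUpper_eq_weighted`, here as a rational identity
in the roots). [cite: CasalsTeixeiradacosta2022, Theorem 3.10 (proof, closing identities)] -/
theorem kdsOmega_weighted (h0 : 0 ≤ r₀) (h01 : r₀ < r₁) (h12 : r₁ < r₂) (ha : 0 < a) :
    kdsOmega r₀ r₁ r₂ a * (kdsW₀ r₀ r₁ r₂ a + kdsW₂ r₀ r₁ r₂ a) =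
      kdsW₀ r₀ r₁ r₂ a * horizonAngVel a r₀ + kdsW₂ r₀ r₁ r₂ a * horizonAngVel a r₂ := by
  have hN := (kdsN_pos (a := a) h0 h01 h12).ne'
  have hP0 := (kdsPi₀_pos h0 h01 h12).ne'
  have hP2 := (kdsPi₂_pos h0 h01 h12).ne'
  have ha0 : r₀ ^ 2 + a ^ 2 ≠ 0 := by positivity
  have ha2 : r₂ ^ 2 + a ^ 2 ≠ 0 := by positivity
  unfold kdsOmega kdsW₀ kdsW₂ horizonAngVel
  field_simp
  unfold kdsN kdsEll kdsL2 kdsPi₀ kdsPi₂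
  ring

/-- Closed form of `D`: `D = (ℓa/N)·2(r₀+r₁)/((r₂−r₀)(r₀+2r₁+r₂))`.
[cite: CasalsTeixeiradacosta2022, Theorem 3.10 (proof, Step 2)] -/
theorem kds_tildeD_eq (h0 : 0 ≤ r₀) (h01 : r₀ < r₁) (h12 : r₁ < r₂) (ha : 0 < a) :
    tildeD (kdsW₁ r₀ r₁ r₂ a) (kdsW₂ r₀ r₁ r₂ a) (horizonAngVel a r₁) (horizonAngVel a r₂)
        (kdsOmega r₀ r₁ r₂ a) =
      kdsEll r₀ r₁ r₂ a * a / kdsN r₀ r₁ r₂ a * (2 * (r₀ + r₁)) /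
        ((r₂ - r₀) * (r₀ + 2 * r₁ + r₂)) := by
  have hN := (kdsN_pos (a := a) h0 h01 h12).ne'
  have hP1 := (kdsPi₁_pos h0 h01 h12).ne'
  have hP2 := (kdsPi₂_pos h0 h01 h12).ne'
  have ha1 : r₁ ^ 2 + a ^ 2 ≠ 0 := by positivity
  have ha2 : r₂ ^ 2 + a ^ 2 ≠ 0 := by positivity
  have h20 : r₂ - r₀ ≠ 0 := by linarith
  have h121 : r₀ + 2 * r₁ + r₂ ≠ 0 := by linarith
  have h21 : r₂ - r₁ ≠ 0 := by linarith
  have h10 : r₁ - r₀ ≠ 0 := by linarith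
  have h122 : r₀ + r₁ + 2 * r₂ ≠ 0 := by linarith
  rw [eq_div_iff (mul_ne_zero h20 h121), div_mul_eq_mul_div, eq_div_iff hN]
  unfold tildeD kdsOmega kdsW₁ kdsW₂ horizonAngVel
  field_simp
  unfold kdsN kdsEll kdsL2 kdsPi₁ kdsPi₂
  ring

/-- Closed form of `F₁`: `F₁ = (ℓa/N)·2(r₁+r₂)/((r₂−r₀)(r₀+2r₁+r₂))`.
[cite: CasalsTeixeiradacosta2022, Theorem 3.10 (proof, Step 2)] -/
theorem kds_tildeF₁_eq (h0 : 0 ≤ r₀) (h01 : r₀ < r₁) (h12 : r₁ < r₂) (ha : 0 < a) :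
    tildeF₁ (kdsW₁ r₀ r₁ r₂ a) (kdsW₂ r₀ r₁ r₂ a) (horizonAngVel a r₁) (horizonAngVel a r₂)
        (kdsOmega r₀ r₁ r₂ a) =
      kdsEll r₀ r₁ r₂ a * a / kdsN r₀ r₁ r₂ a * (2 * (r₁ + r₂)) /
        ((r₂ - r₀) * (r₀ + 2 * r₁ + r₂)) := by
  have hN := (kdsN_pos (a := a) h0 h01 h12).ne'
  have hP1 := (kdsPi₁_pos h0 h01 h12).ne'
  have hP2 := (kdsPi₂_pos h0 h01 h12).ne'
  have ha1 : r₁ ^ 2 + a ^ 2 ≠ 0 := by positivity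
  have ha2 : r₂ ^ 2 + a ^ 2 ≠ 0 := by positivity
  have h20 : r₂ - r₀ ≠ 0 := by linarith
  have h121 : r₀ + 2 * r₁ + r₂ ≠ 0 := by linarith
  have h21 : r₂ - r₁ ≠ 0 := by linarith
  have h10 : r₁ - r₀ ≠ 0 := by linarith
  have h122 : r₀ + r₁ + 2 * r₂ ≠ 0 := by linarith
  rw [eq_div_iff (mul_ne_zero h20 h121), div_mul_eq_mul_div, eq_div_iff hN]
  unfold tildeF₁ kdsOmega kdsW₁ kdsW₂ horizonAngVel
  field_simp
  unfold kdsN kdsEll kdsL2 kdsPi₁ kdsPi₂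
  ring

/-- Closed form of `F₂`: `F₂ = (ℓa/N)·2(r₁+r₂)(4a²+(r₀+r₁)²)/((r₁−r₀)(r₀+2r₁+r₂)(r₂−r₀)(r₀+r₁+2r₂))`.
[cite: CasalsTeixeiradacosta2022, Theorem 3.10 (proof, Step 2)] -/
theorem kds_tildeF₂_eq (h0 : 0 ≤ r₀) (h01 : r₀ < r₁) (h12 : r₁ < r₂) (ha : 0 < a) :
    tildeF₂ (kdsW₁ r₀ r₁ r₂ a) (kdsW₂ r₀ r₁ r₂ a) (horizonAngVel a r₁) (horizonAngVel a r₂)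
        (kdsOmega r₀ r₁ r₂ a) =
      kdsEll r₀ r₁ r₂ a * a / kdsN r₀ r₁ r₂ a * (2 * (r₁ + r₂) * (4 * a ^ 2 + (r₀ + r₁) ^ 2)) /
        ((r₁ - r₀) * (r₀ + 2 * r₁ + r₂) * (r₂ - r₀) * (r₀ + r₁ + 2 * r₂)) := by
  have hN := (kdsN_pos (a := a) h0 h01 h12).ne'
  have hP1 := (kdsPi₁_pos h0 h01 h12).ne'
  have hP2 := (kdsPi₂_pos h0 h01 h12).ne'
  have ha1 : r₁ ^ 2 + a ^ 2 ≠ 0 := by positivity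
  have ha2 : r₂ ^ 2 + a ^ 2 ≠ 0 := by positivity
  have h20 : r₂ - r₀ ≠ 0 := by linarith
  have h121 : r₀ + 2 * r₁ + r₂ ≠ 0 := by linarith
  have h21 : r₂ - r₁ ≠ 0 := by linarith
  have h10 : r₁ - r₀ ≠ 0 := by linarith
  have h122 : r₀ + r₁ + 2 * r₂ ≠ 0 := by linarith
  rw [eq_div_iff (mul_ne_zero (mul_ne_zero (mul_ne_zero h10 h121) h20) h122), div_mul_eq_mul_div,
    eq_div_iff hN]
  unfold tildeF₂ kdsOmega kdsW₁ kdsW₂ horizonAngVel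
  field_simp
  unfold kdsN kdsEll kdsL2 kdsPi₁ kdsPi₂
  ring

/-- Closed form of `F₃`: `F₃ = (ℓa/N)·2(r₀+r₁)(4a²+(r₁+r₂)²)/((r₂−r₀)(2r₀+r₁+r₂)(r₂−r₁)(r₀+2r₁+r₂))`.
[cite: CasalsTeixeiradacosta2022, Theorem 3.10 (proof, Step 2)] -/
theorem kds_tildeF₃_eq (h0 : 0 ≤ r₀) (h01 : r₀ < r₁) (h12 : r₁ < r₂) (ha : 0 < a) :
    tildeF₃ (kdsW₀ r₀ r₁ r₂ a) (kdsW₁ r₀ r₁ r₂ a) (horizonAngVel a r₀) (horizonAngVel a r₁)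
        (kdsOmega r₀ r₁ r₂ a) =
      kdsEll r₀ r₁ r₂ a * a / kdsN r₀ r₁ r₂ a * (2 * (r₀ + r₁) * (4 * a ^ 2 + (r₁ + r₂) ^ 2)) /
        ((r₂ - r₀) * (2 * r₀ + r₁ + r₂) * (r₂ - r₁) * (r₀ + 2 * r₁ + r₂)) := by
  have hN := (kdsN_pos (a := a) h0 h01 h12).ne'
  have hP0 := (kdsPi₀_pos h0 h01 h12).ne'
  have hP1 := (kdsPi₁_pos h0 h01 h12).ne'
  have ha0 : r₀ ^ 2 + a ^ 2 ≠ 0 := by positivity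
  have ha1 : r₁ ^ 2 + a ^ 2 ≠ 0 := by positivity
  have h20 : r₂ - r₀ ≠ 0 := by linarith
  have h120 : 2 * r₀ + r₁ + r₂ ≠ 0 := by linarith
  have h121 : r₀ + 2 * r₁ + r₂ ≠ 0 := by linarith
  have h21 : r₂ - r₁ ≠ 0 := by linarith
  have h10 : r₁ - r₀ ≠ 0 := by linarith
  rw [eq_div_iff (mul_ne_zero (mul_ne_zero (mul_ne_zero h20 h120) h21) h121), div_mul_eq_mul_div,
    eq_div_iff hN]
  unfold tildeF₃ kdsOmega kdsW₀ kdsW₁ horizonAngVel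
  field_simp
  unfold kdsN kdsEll kdsL2 kdsPi₀ kdsPi₁
  ring

/-- `D > 0` (equivalently `Ω_SR` exceeds the `κ`-weighted mean of `ϖ₁, ϖ₂`; reduces to `2(r₀+r₁) > 0`).
[cite: CasalsTeixeiradacosta2022, Theorem 3.10 (proof, Step 2)] -/
theorem kds_tildeD_pos (h0 : 0 ≤ r₀) (h01 : r₀ < r₁) (h12 : r₁ < r₂) (ha : 0 < a) :
    0 < tildeD (kdsW₁ r₀ r₁ r₂ a) (kdsW₂ r₀ r₁ r₂ a) (horizonAngVel a r₁) (horizonAngVel a r₂)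
      (kdsOmega r₀ r₁ r₂ a) := by
  rw [kds_tildeD_eq h0 h01 h12 ha]
  have hℓ := kdsEll_pos (a := a) h0 h01 h12
  have hN := kdsN_pos (a := a) h0 h01 h12
  have h1 : 0 < kdsEll r₀ r₁ r₂ a * a / kdsN r₀ r₁ r₂ a := div_pos (mul_pos hℓ ha) hN
  exact div_pos (mul_pos h1 (by linarith)) (mul_pos (by linarith) (by linarith))

/-- `F₁ > 0` (i.e. `ϖ₂ < Ω_SR < ϖ₁`, weighted). [cite: CasalsTeixeiradacosta2022, Theorem 3.10 (proof, Step 2)] -/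
theorem kds_tildeF₁_pos (h0 : 0 ≤ r₀) (h01 : r₀ < r₁) (h12 : r₁ < r₂) (ha : 0 < a) :
    0 < tildeF₁ (kdsW₁ r₀ r₁ r₂ a) (kdsW₂ r₀ r₁ r₂ a) (horizonAngVel a r₁) (horizonAngVel a r₂)
      (kdsOmega r₀ r₁ r₂ a) := by
  rw [kds_tildeF₁_eq h0 h01 h12 ha]
  have hℓ := kdsEll_pos (a := a) h0 h01 h12
  have hN := kdsN_pos (a := a) h0 h01 h12
  have hr₁ : 0 < r₁ := lt_of_le_of_lt h0 h01
  have h1 : 0 < kdsEll r₀ r₁ r₂ a * a / kdsN r₀ r₁ r₂ a := div_pos (mul_pos hℓ ha) hN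
  exact div_pos (mul_pos h1 (by linarith)) (mul_pos (by linarith) (by linarith))

/-- `F₂ > 0`. [cite: CasalsTeixeiradacosta2022, Theorem 3.10 (proof, Step 2)] -/
theorem kds_tildeF₂_pos (h0 : 0 ≤ r₀) (h01 : r₀ < r₁) (h12 : r₁ < r₂) (ha : 0 < a) :
    0 < tildeF₂ (kdsW₁ r₀ r₁ r₂ a) (kdsW₂ r₀ r₁ r₂ a) (horizonAngVel a r₁) (horizonAngVel a r₂)
      (kdsOmega r₀ r₁ r₂ a) := by
  rw [kds_tildeF₂_eq h0 h01 h12 ha]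
  have hℓ := kdsEll_pos (a := a) h0 h01 h12
  have hN := kdsN_pos (a := a) h0 h01 h12
  have hr₁ : 0 < r₁ := lt_of_le_of_lt h0 h01
  have h1 : 0 < kdsEll r₀ r₁ r₂ a * a / kdsN r₀ r₁ r₂ a := div_pos (mul_pos hℓ ha) hN
  have h2 : 0 < 2 * (r₁ + r₂) * (4 * a ^ 2 + (r₀ + r₁) ^ 2) :=
    mul_pos (by linarith) (by positivity)
  exact div_pos (mul_pos h1 h2)
    (mul_pos (mul_pos (mul_pos (by linarith) (by linarith)) (by linarith)) (by linarith))

/-- `F₃ > 0`. [cite: CasalsTeixeiradacosta2022, Theorem 3.10 (proof, Step 2)] -/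
theorem kds_tildeF₃_pos (h0 : 0 ≤ r₀) (h01 : r₀ < r₁) (h12 : r₁ < r₂) (ha : 0 < a) :
    0 < tildeF₃ (kdsW₀ r₀ r₁ r₂ a) (kdsW₁ r₀ r₁ r₂ a) (horizonAngVel a r₀) (horizonAngVel a r₁)
      (kdsOmega r₀ r₁ r₂ a) := by
  rw [kds_tildeF₃_eq h0 h01 h12 ha]
  have hℓ := kdsEll_pos (a := a) h0 h01 h12
  have hN := kdsN_pos (a := a) h0 h01 h12
  have hr₁ : 0 < r₁ := lt_of_le_of_lt h0 h01
  have h1 : 0 < kdsEll r₀ r₁ r₂ a * a / kdsN r₀ r₁ r₂ a := div_pos (mul_pos hℓ ha) hN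
  have h2 : 0 < 2 * (r₀ + r₁) * (4 * a ^ 2 + (r₁ + r₂) ^ 2) :=
    mul_pos (by linarith) (by positivity)
  exact div_pos (mul_pos h1 h2)
    (mul_pos (mul_pos (mul_pos (by linarith) (by linarith)) (by linarith)) (by linarith))

/-- The key polynomial inequality behind `h₁ > 0`: `a²((r₂−r₀)(r₀+2r₁+r₂))² < L²(r₁+r₂)²(4a²+(r₀+r₁)²)`
(`(r₂−r₀)(r₀+2r₁+r₂) = (r₁+r₂)² − (r₀+r₁)²` and `(r₁+r₂)² < 4(r₁²+r₂²+r₁r₂) ≤ 4L²`, i.e. `r₁+r₂ < 2L`).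
[cite: CasalsTeixeiradacosta2022, Theorem 3.10 (proof, Step 2)] -/
theorem kds_key_ineq (h0 : 0 ≤ r₀) (h01 : r₀ < r₁) (h12 : r₁ < r₂) (ha : 0 < a) :
    a ^ 2 * ((r₂ - r₀) * (r₀ + 2 * r₁ + r₂)) ^ 2 <
      kdsL2 r₀ r₁ r₂ a * (r₁ + r₂) ^ 2 * (4 * a ^ 2 + (r₀ + r₁) ^ 2) := by
  have hr₁ : 0 < r₁ := lt_of_le_of_lt h0 h01
  have hL : 0 < kdsL2 r₀ r₁ r₂ a := kdsL2_pos h0 h01 h12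
  have hL4 : (r₁ + r₂) ^ 2 < 4 * kdsL2 r₀ r₁ r₂ a := by
    unfold kdsL2
    nlinarith [sq_nonneg a, mul_nonneg h0 hr₁.le, mul_nonneg h0 (hr₁.trans h12).le]
  set Q := (r₁ + r₂) ^ 2 with hQ
  set P := (r₀ + r₁) ^ 2 with hP
  set L := kdsL2 r₀ r₁ r₂ a with hLdef
  have hK : (r₂ - r₀) * (r₀ + 2 * r₁ + r₂) = Q - P := by rw [hQ, hP]; ring
  rw [hK]
  have hQpos : 0 < Q := by rw [hQ]; exact pow_pos (by linarith) 2
  have hPpos : 0 < P := by rw [hP]; exact pow_pos (by linarith) 2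
  have hPQ : P < Q := by rw [hQ, hP]; nlinarith
  have h1 : (Q - P) ^ 2 ≤ Q ^ 2 := by nlinarith
  have ha2 : 0 < a ^ 2 := by positivity
  have h2 : a ^ 2 * (Q - P) ^ 2 ≤ a ^ 2 * Q ^ 2 := mul_le_mul_of_nonneg_left h1 ha2.le
  have h3 : a ^ 2 * Q ^ 2 < L * Q * (4 * a ^ 2) := by
    have := mul_pos (mul_pos ha2 hQpos) (sub_pos.2 hL4)
    nlinarith
  have h4 : L * Q * (4 * a ^ 2) ≤ L * Q * (4 * a ^ 2 + P) :=
    mul_le_mul_of_nonneg_left (by linarith) (mul_nonneg hL.le hQpos.le)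
  linarith

/-- **`Ω²c < F₁F₂`** (so `h₁ = h₀ + F₁F₂ − Ω²c > h₀`): the `a²|ω|²` term of (3.28) is dominated.
[cite: CasalsTeixeiradacosta2022, Theorem 3.10 (proof, Step 2)] -/
theorem kds_OmegaSq_mul_c_lt (h0 : 0 ≤ r₀) (h01 : r₀ < r₁) (h12 : r₁ < r₂) (ha : 0 < a) :
    kdsOmega r₀ r₁ r₂ a ^ 2 * kdsC r₀ r₁ r₂ a <
      tildeF₁ (kdsW₁ r₀ r₁ r₂ a) (kdsW₂ r₀ r₁ r₂ a) (horizonAngVel a r₁) (horizonAngVel a r₂)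
          (kdsOmega r₀ r₁ r₂ a) *
        tildeF₂ (kdsW₁ r₀ r₁ r₂ a) (kdsW₂ r₀ r₁ r₂ a) (horizonAngVel a r₁) (horizonAngVel a r₂)
          (kdsOmega r₀ r₁ r₂ a) := by
  rw [kds_tildeF₁_eq h0 h01 h12 ha, kds_tildeF₂_eq h0 h01 h12 ha]
  have hℓ := kdsEll_pos (a := a) h0 h01 h12
  have hN := kdsN_pos (a := a) h0 h01 h12
  have hL := kdsL2_pos (a := a) h0 h01 h12
  have hr₁ : 0 < r₁ := lt_of_le_of_lt h0 h01
  have h10 : 0 < r₁ - r₀ := by linarith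
  have h20 : 0 < r₂ - r₀ := by linarith
  have h121 : 0 < r₀ + 2 * r₁ + r₂ := by linarith
  have h122 : 0 < r₀ + r₁ + 2 * r₂ := by linarith
  have hkey := kds_key_ineq h0 h01 h12 ha
  -- common positive factor `K = ℓ²a²/(N²(r₁−r₀)(r₀+r₁+2r₂))`
  set K := kdsEll r₀ r₁ r₂ a ^ 2 * a ^ 2 /
    (kdsN r₀ r₁ r₂ a ^ 2 * ((r₁ - r₀) * (r₀ + r₁ + 2 * r₂))) with hK
  have hKpos : 0 < K := by rw [hK]; positivity
  have eL : kdsOmega r₀ r₁ r₂ a ^ 2 * kdsC r₀ r₁ r₂ a = K * (4 * a ^ 2 / kdsL2 r₀ r₁ r₂ a) := by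
    rw [hK]; unfold kdsOmega kdsC
    field_simp
    ring
  have eR : kdsEll r₀ r₁ r₂ a * a / kdsN r₀ r₁ r₂ a * (2 * (r₁ + r₂)) /
        ((r₂ - r₀) * (r₀ + 2 * r₁ + r₂)) *
      (kdsEll r₀ r₁ r₂ a * a / kdsN r₀ r₁ r₂ a * (2 * (r₁ + r₂) * (4 * a ^ 2 + (r₀ + r₁) ^ 2)) /
        ((r₁ - r₀) * (r₀ + 2 * r₁ + r₂) * (r₂ - r₀) * (r₀ + r₁ + 2 * r₂))) =
      K * (4 * (r₁ + r₂) ^ 2 * (4 * a ^ 2 + (r₀ + r₁) ^ 2) /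
        ((r₂ - r₀) * (r₀ + 2 * r₁ + r₂)) ^ 2) := by
    rw [hK]
    field_simp
    ring
  rw [eL, eR]
  apply mul_lt_mul_of_pos_left _ hKpos
  rw [div_lt_div_iff₀ hL (by positivity)]
  nlinarith

/-- **`c ≤ 4w₁w₂`** (in fact `c·κ₁κ₂ ≤ 1/8`; reduces to `r₂ < L`): makes `A(z) > 0` on `(1, z₂)`.
[cite: CasalsTeixeiradacosta2022, Theorem 3.10 (proof, Step 2)] -/
theorem kds_c_le (h0 : 0 ≤ r₀) (h01 : r₀ < r₁) (h12 : r₁ < r₂) (ha : 0 < a) :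
    kdsC r₀ r₁ r₂ a ≤ 4 * kdsW₁ r₀ r₁ r₂ a * kdsW₂ r₀ r₁ r₂ a := by
  have hℓ := kdsEll_pos (a := a) h0 h01 h12
  have hL := kdsL2_pos (a := a) h0 h01 h12
  have hP1 := kdsPi₁_pos h0 h01 h12
  have hP2 := kdsPi₂_pos h0 h01 h12
  have hr₁ : 0 < r₁ := lt_of_le_of_lt h0 h01
  have h10 : 0 < r₁ - r₀ := by linarith
  have h122 : 0 < r₀ + r₁ + 2 * r₂ := by linarith
  -- reduce to the polynomial inequality
  have key : a ^ 2 * ((r₂ - r₁) ^ 2 * (r₀ + 2 * r₁ + r₂) * (r₂ - r₀)) ≤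
      4 * kdsL2 r₀ r₁ r₂ a * (r₁ ^ 2 + a ^ 2) * (r₂ ^ 2 + a ^ 2) := by
    unfold kdsL2
    have e : (r₂ - r₀) * (r₀ + 2 * r₁ + r₂) = (r₁ + r₂) ^ 2 - (r₀ + r₁) ^ 2 := by ring
    have h1 : (r₂ - r₁) ^ 2 ≤ r₂ ^ 2 := by nlinarith
    have h2 : (r₀ + 2 * r₁ + r₂) * (r₂ - r₀) ≤ 4 * r₂ ^ 2 := by nlinarith
    have h3 : (r₂ - r₁) ^ 2 * (r₀ + 2 * r₁ + r₂) * (r₂ - r₀) ≤ r₂ ^ 2 * (4 * r₂ ^ 2) := by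
      have := mul_le_mul h1 h2 (mul_nonneg (by linarith) (by linarith)) (sq_nonneg _)
      linarith [this]
    have ha2 : 0 ≤ a ^ 2 := sq_nonneg a
    have h4 : a ^ 2 * ((r₂ - r₁) ^ 2 * (r₀ + 2 * r₁ + r₂) * (r₂ - r₀)) ≤
        a ^ 2 * (r₂ ^ 2 * (4 * r₂ ^ 2)) := mul_le_mul_of_nonneg_left h3 ha2
    have h5 : r₂ ^ 2 ≤ a ^ 2 + (r₀ ^ 2 + r₁ ^ 2 + r₂ ^ 2 + r₀ * r₁ + r₀ * r₂ + r₁ * r₂) := by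
      nlinarith [mul_nonneg h0 hr₁.le, mul_nonneg h0 (hr₁.trans h12).le]
    have h6 : a ^ 2 ≤ r₁ ^ 2 + a ^ 2 := by nlinarith
    have h7 : r₂ ^ 2 ≤ r₂ ^ 2 + a ^ 2 := by nlinarith
    have h8 : a ^ 2 * (r₂ ^ 2 * (4 * r₂ ^ 2)) = 4 * r₂ ^ 2 * a ^ 2 * r₂ ^ 2 := by ring
    have h9 : 4 * r₂ ^ 2 * a ^ 2 * r₂ ^ 2 ≤
        4 * (a ^ 2 + (r₀ ^ 2 + r₁ ^ 2 + r₂ ^ 2 + r₀ * r₁ + r₀ * r₂ + r₁ * r₂)) *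
          (r₁ ^ 2 + a ^ 2) * (r₂ ^ 2 + a ^ 2) := by
      have t1 : 4 * r₂ ^ 2 ≤
          4 * (a ^ 2 + (r₀ ^ 2 + r₁ ^ 2 + r₂ ^ 2 + r₀ * r₁ + r₀ * r₂ + r₁ * r₂)) := by linarith
      have := mul_le_mul (mul_le_mul t1 h6 ha2 (by positivity)) h7 (sq_nonneg _) (by positivity)
      linarith [this]
    linarith
  unfold kdsC kdsW₁ kdsW₂
  rw [div_le_iff₀ (by positivity)]
  have e : 4 * (kdsEll r₀ r₁ r₂ a * (r₁ ^ 2 + a ^ 2) / kdsPi₁ r₀ r₁ r₂) *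
        (kdsEll r₀ r₁ r₂ a * (r₂ ^ 2 + a ^ 2) / kdsPi₂ r₀ r₁ r₂) *
      (kdsL2 r₀ r₁ r₂ a * ((r₁ - r₀) * (r₀ + r₁ + 2 * r₂))) =
      kdsEll r₀ r₁ r₂ a ^ 2 * (4 * kdsL2 r₀ r₁ r₂ a * (r₁ ^ 2 + a ^ 2) * (r₂ ^ 2 + a ^ 2)) /
        ((r₂ - r₁) ^ 2 * (r₀ + 2 * r₁ + r₂) * (r₂ - r₀)) := by
    have h21 : r₂ - r₁ ≠ 0 := by linarith
    have h20 : r₂ - r₀ ≠ 0 := by linarith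
    have h121 : r₀ + 2 * r₁ + r₂ ≠ 0 := by linarith
    have hP1' := hP1.ne'
    have hP2' := hP2.ne'
    rw [eq_div_iff (mul_ne_zero (mul_ne_zero (pow_ne_zero 2 h21) h121) h20)]
    field_simp
    unfold kdsPi₁ kdsPi₂
    ring
  rw [e, le_div_iff₀ (by nlinarith [mul_pos (mul_pos (pow_pos (show (0:ℝ) < r₂ - r₁ by linarith) 2)
    (show (0:ℝ) < r₀ + 2 * r₁ + r₂ by linarith)) (show (0:ℝ) < r₂ - r₀ by linarith)])]
  have hℓ2 : 0 ≤ kdsEll r₀ r₁ r₂ a ^ 2 := sq_nonneg _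
  nlinarith [mul_le_mul_of_nonneg_left key hℓ2]

/-- **The right side of (3.28) is positive on `(1, z₂)` in the full subextremal range** — the printed
"One can verify …", verified: for roots `0 ≤ r₀ < r₁ < r₂`, `a > 0`, any `z₂ > 1`, weights
`W ≥ μΩ²` (`W = |ω|² > 0`, `μ = m² ≥ 0`), `W·A(z) − μ·B(z) > 0`.
[cite: CasalsTeixeiradacosta2022, Theorem 3.10 (proof, Step 2), (3.28)–(3.30)] -/
theorem kds_tildeRHS_pos (h0 : 0 ≤ r₀) (h01 : r₀ < r₁) (h12 : r₁ < r₂) (ha : 0 < a) {z₂ : ℝ}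
    (hz₂ : 1 < z₂) {W μ : ℝ} (hW : 0 < W) (hμ : 0 ≤ μ) (hWμ : μ * kdsOmega r₀ r₁ r₂ a ^ 2 ≤ W)
    {z : ℝ} (hz : z ∈ Ioo 1 z₂) :
    0 < W * tildeA (kdsW₀ r₀ r₁ r₂ a) (kdsW₁ r₀ r₁ r₂ a) (kdsW₂ r₀ r₁ r₂ a) (kdsC r₀ r₁ r₂ a) z₂ z -
      μ * tildeB (kdsW₀ r₀ r₁ r₂ a) (kdsW₁ r₀ r₁ r₂ a) (kdsW₂ r₀ r₁ r₂ a) (horizonAngVel a r₀)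
        (horizonAngVel a r₁) (horizonAngVel a r₂) z₂ z :=
  tildeRHS_pos hz₂ (kdsOmega_weighted h0 h01 h12 ha) (kds_tildeD_pos h0 h01 h12 ha)
    (kds_tildeF₃_pos h0 h01 h12 ha) (kds_tildeF₁_pos h0 h01 h12 ha).le
    (kds_tildeF₂_pos h0 h01 h12 ha).le (kds_OmegaSq_mul_c_lt h0 h01 h12 ha).le
    (mul_pos (kdsW₁_pos h0 h01 h12 ha) (kdsW₂_pos h0 h01 h12 ha)) (kds_c_le h0 h01 h12 ha)
    hW hμ hWμ hz

end RootCoordinates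

/-! ### Instantiation on subextremal Kerr–de Sitter: the tree's `κ_j`, `ϖ_j`, `η_j`, `Ω_SR` -/

section Instantiation

variable {M a Λ : ℝ}

/-- `3/Λ = kdsL2 r₋ r₊ r_c a` (the `r²`-Vieta relation `vieta_sq`, solved for `L² = 3/Λ`).
[cite: CasalsTeixeiradacosta2022, (3.2)] -/
theorem three_div_eq_kdsL2 (hsub : IsSubextremal M a Λ) :
    3 / Λ = kdsL2 (rMinus M a Λ) (rPlus M a Λ) (rCosmo M a Λ) a := by
  have hv := vieta_sq hsub
  unfold kdsL2
  rw [div_eq_iff hsub.2.1.ne']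
  linear_combination 3 * hv

/-- `1/(2κ₀) = w₀` (closed form (3.10) of the Cauchy-horizon surface gravity).
[cite: CasalsTeixeiradacosta2022, (3.10)] -/
theorem inv_two_surfaceGravity_rMinus (hsub : IsSubextremal M a Λ) (ha : a ≠ 0) :
    1 / (2 * surfaceGravity M a Λ (rMinus M a Λ)) =
      kdsW₀ (rMinus M a Λ) (rPlus M a Λ) (rCosmo M a Λ) a := by
  rw [surfaceGravity_rMinus_eq hsub]
  have hx := rMinus_pos hsub ha
  have hL := three_div_eq_kdsL2 hsub
  obtain ⟨hM, hΛ, h01, h12, -⟩ := hsub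
  have hξ := (xi_pos hΛ.le a).ne'
  have h1 : rPlus M a Λ - rMinus M a Λ ≠ 0 := by linarith
  have h2 : rCosmo M a Λ - rMinus M a Λ ≠ 0 := by linarith
  have h3 : 2 * rMinus M a Λ + rPlus M a Λ + rCosmo M a Λ ≠ 0 := by linarith
  have h4 : rMinus M a Λ ^ 2 + a ^ 2 ≠ 0 := by positivity
  have hΛ' : Λ ≠ 0 := hΛ.ne'
  unfold kdsW₀ kdsEll kdsPi₀
  rw [← hL]
  unfold xi
  field_simp

/-- `1/(2κ₁) = w₁`. [cite: CasalsTeixeiradacosta2022, (3.10)] -/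
theorem inv_two_surfaceGravity_rPlus (hsub : IsSubextremal M a Λ) (ha : a ≠ 0) :
    1 / (2 * surfaceGravity M a Λ (rPlus M a Λ)) =
      kdsW₁ (rMinus M a Λ) (rPlus M a Λ) (rCosmo M a Λ) a := by
  rw [surfaceGravity_rPlus_eq hsub]
  have hx := rMinus_pos hsub ha
  have hL := three_div_eq_kdsL2 hsub
  obtain ⟨hM, hΛ, h01, h12, -⟩ := hsub
  have hξ := (xi_pos hΛ.le a).ne'
  have h1 : rPlus M a Λ - rMinus M a Λ ≠ 0 := by linarith
  have h2 : rCosmo M a Λ - rPlus M a Λ ≠ 0 := by linarith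
  have h3 : rMinus M a Λ + 2 * rPlus M a Λ + rCosmo M a Λ ≠ 0 := by linarith
  have h4 : rPlus M a Λ ^ 2 + a ^ 2 ≠ 0 := by positivity
  have hΛ' : Λ ≠ 0 := hΛ.ne'
  unfold kdsW₁ kdsEll kdsPi₁
  rw [← hL]
  unfold xi
  field_simp

/-- `1/(2κ₂) = w₂`. [cite: CasalsTeixeiradacosta2022, (3.10)] -/
theorem inv_two_surfaceGravity_rCosmo (hsub : IsSubextremal M a Λ) (ha : a ≠ 0) :
    1 / (2 * surfaceGravity M a Λ (rCosmo M a Λ)) =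
      kdsW₂ (rMinus M a Λ) (rPlus M a Λ) (rCosmo M a Λ) a := by
  rw [surfaceGravity_rCosmo_eq hsub]
  have hx := rMinus_pos hsub ha
  have hL := three_div_eq_kdsL2 hsub
  obtain ⟨hM, hΛ, h01, h12, -⟩ := hsub
  have hξ := (xi_pos hΛ.le a).ne'
  have h1 : rCosmo M a Λ - rMinus M a Λ ≠ 0 := by linarith
  have h2 : rCosmo M a Λ - rPlus M a Λ ≠ 0 := by linarith
  have h3 : rMinus M a Λ + rPlus M a Λ + 2 * rCosmo M a Λ ≠ 0 := by linarith
  have h4 : rCosmo M a Λ ^ 2 + a ^ 2 ≠ 0 := by positivity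
  have hΛ' : Λ ≠ 0 := hΛ.ne'
  unfold kdsW₂ kdsEll kdsPi₂
  rw [← hL]
  unfold xi
  field_simp

/-- `Ω_SR = superradiantUpper = kdsOmega r₋ r₊ r_c a`. [cite: CasalsTeixeiradacosta2022, Theorem 2] -/
theorem superradiantUpper_eq_kdsOmega (hsub : IsSubextremal M a Λ) :
    superradiantUpper M a Λ = kdsOmega (rMinus M a Λ) (rPlus M a Λ) (rCosmo M a Λ) a := by
  unfold superradiantUpper kdsOmega kdsN kdsEll
  rw [three_div_eq_kdsL2 hsub]
  ring

/-- `η₀ = I·w₀·(ω − mϖ₀)`. [cite: CasalsTeixeiradacosta2022, (3.10)] -/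
theorem etaCauchy_eq_I_mul (hsub : IsSubextremal M a Λ) (ha : a ≠ 0) (ω : ℂ) (m : ℝ) :
    etaCauchy M a Λ ω m =
      I * ((kdsW₀ (rMinus M a Λ) (rPlus M a Λ) (rCosmo M a Λ) a : ℂ) *
        (ω - ((m * horizonAngVel a (rMinus M a Λ) : ℝ) : ℂ))) := by
  unfold etaCauchy
  rw [etaOf_eq_I_mul, one_mul, inv_two_surfaceGravity_rMinus hsub ha]

/-- `η₁ = −I·w₁·(ω − mϖ₁)`. [cite: CasalsTeixeiradacosta2022, (3.10)] -/
theorem etaEvent_eq_I_mul (hsub : IsSubextremal M a Λ) (ha : a ≠ 0) (ω : ℂ) (m : ℝ) :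
    etaEvent M a Λ ω m =
      I * (-(kdsW₁ (rMinus M a Λ) (rPlus M a Λ) (rCosmo M a Λ) a : ℂ) *
        (ω - ((m * horizonAngVel a (rPlus M a Λ) : ℝ) : ℂ))) := by
  unfold etaEvent
  rw [etaOf_eq_I_mul, neg_one_mul, ← inv_two_surfaceGravity_rPlus hsub ha]
  push_cast
  ring

/-- `η₂ = I·w₂·(ω − mϖ₂)`. [cite: CasalsTeixeiradacosta2022, (3.10)] -/
theorem etaCosmo_eq_I_mul (hsub : IsSubextremal M a Λ) (ha : a ≠ 0) (ω : ℂ) (m : ℝ) :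
    etaCosmo M a Λ ω m =
      I * ((kdsW₂ (rMinus M a Λ) (rPlus M a Λ) (rCosmo M a Λ) a : ℂ) *
        (ω - ((m * horizonAngVel a (rCosmo M a Λ) : ℝ) : ℂ))) := by
  unfold etaCosmo
  rw [etaOf_eq_I_mul, one_mul, inv_two_surfaceGravity_rCosmo hsub ha]

/-- The `λ̄`-block of (3.25)/(3.27): `LT = L²(λ̄ − 2Ξ²amω + Ξ²a²ω²)/((r₂−r₃)(r₁−r₀))`, `L² = 3/Λ`,
`r₃ = −(r₀+r₁+r₂)` (with `Ξ²` on the `amω` term as in (3.15b); the held text prints `Ξ¹` in (3.27)).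
[cite: CasalsTeixeiradacosta2022, (3.25) and (3.27)] -/
def ctdcLT (M a Λ : ℝ) (ω : ℂ) (m : ℝ) (lamBar : ℂ) : ℂ :=
  ((3 / Λ / ((rCosmo M a Λ + (rMinus M a Λ + rPlus M a Λ + rCosmo M a Λ)) *
      (rPlus M a Λ - rMinus M a Λ)) : ℝ) : ℂ) *
    (lamBar - 2 * (xi a Λ : ℂ) ^ 2 * (a : ℂ) * (m : ℂ) * ω + (xi a Λ : ℂ) ^ 2 * (a : ℂ) ^ 2 * ω ^ 2)

/-- `Im(c̄ (λ̄ − k₁ c + k₂ c²)) = Im(c̄ λ̄) + k₂|c|² Im c` for real `k₁, k₂` (pure algebra).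
[cite: CasalsTeixeiradacosta2022, Theorem 3.10 (proof, Step 2)] -/
theorem im_conj_mul_lamBlock (c lamBar : ℂ) (k₁ k₂ : ℝ) :
    (conj c * (lamBar - (k₁ : ℂ) * c + (k₂ : ℂ) * c ^ 2)).im =
      (conj c * lamBar).im + k₂ * normSq c * c.im := by
  simp only [pow_two, mul_im, mul_re, add_im, add_re, sub_im, sub_re, ofReal_re, ofReal_im,
    conj_re, conj_im, normSq_apply]
  ring

/-- `Im(ω̄ · LT) = (3/Λ)/((r₂−r₃)(r₁−r₀)) · (Im(ω̄ λ̄) + Ξ²a²|ω|² Im ω)` (the `amω` term drops out).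
[cite: CasalsTeixeiradacosta2022, Theorem 3.10 (proof, Step 2)] -/
theorem im_conj_mul_ctdcLT (M a Λ : ℝ) (ω : ℂ) (m : ℝ) (lamBar : ℂ) :
    (conj ω * ctdcLT M a Λ ω m lamBar).im =
      3 / Λ / ((rCosmo M a Λ + (rMinus M a Λ + rPlus M a Λ + rCosmo M a Λ)) *
          (rPlus M a Λ - rMinus M a Λ)) *
        ((conj ω * lamBar).im + xi a Λ ^ 2 * a ^ 2 * normSq ω * ω.im) := by
  unfold ctdcLT
  have e : conj ω * (((3 / Λ / ((rCosmo M a Λ + (rMinus M a Λ + rPlus M a Λ + rCosmo M a Λ)) *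
      (rPlus M a Λ - rMinus M a Λ)) : ℝ) : ℂ) *
      (lamBar - 2 * (xi a Λ : ℂ) ^ 2 * (a : ℂ) * (m : ℂ) * ω + (xi a Λ : ℂ) ^ 2 * (a : ℂ) ^ 2 * ω ^ 2)) =
      ((3 / Λ / ((rCosmo M a Λ + (rMinus M a Λ + rPlus M a Λ + rCosmo M a Λ)) *
        (rPlus M a Λ - rMinus M a Λ)) : ℝ) : ℂ) *
        (conj ω * (lamBar - ((2 * xi a Λ ^ 2 * a * m : ℝ) : ℂ) * ω +
          ((xi a Λ ^ 2 * a ^ 2 : ℝ) : ℂ) * ω ^ 2)) := by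
    push_cast; ring
  rw [e, im_ofReal_mul, im_conj_mul_lamBlock]

/-- `(3/Λ)Ξ²a²/((r₂−r₃)(r₁−r₀)) = c` (the kept `a²|ω|²` coefficient, in root coordinates).
[cite: CasalsTeixeiradacosta2022, (3.28)] -/
theorem ctdcLT_coeff_eq_kdsC (hsub : IsSubextremal M a Λ) :
    3 / Λ / ((rCosmo M a Λ + (rMinus M a Λ + rPlus M a Λ + rCosmo M a Λ)) *
        (rPlus M a Λ - rMinus M a Λ)) * (xi a Λ ^ 2 * a ^ 2) =
      kdsC (rMinus M a Λ) (rPlus M a Λ) (rCosmo M a Λ) a := by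
  have hL := three_div_eq_kdsL2 hsub
  have h0 := rMinus_nonneg M a Λ
  obtain ⟨hM, hΛ, h01, h12, -⟩ := hsub
  have hLpos : 0 < kdsL2 (rMinus M a Λ) (rPlus M a Λ) (rCosmo M a Λ) a := kdsL2_pos h0 h01 h12
  have h1 : rPlus M a Λ - rMinus M a Λ ≠ 0 := by linarith
  have h2 : rCosmo M a Λ + (rMinus M a Λ + rPlus M a Λ + rCosmo M a Λ) ≠ 0 := by linarith
  have h2' : rCosmo M a Λ * 2 + rMinus M a Λ + rPlus M a Λ ≠ 0 := by linarith
  have hxi : xi a Λ = kdsEll (rMinus M a Λ) (rPlus M a Λ) (rCosmo M a Λ) a /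
      kdsL2 (rMinus M a Λ) (rPlus M a Λ) (rCosmo M a Λ) a := by
    unfold kdsEll xi
    rw [← hL]
    field_simp
  unfold kdsC
  rw [show (rCosmo M a Λ + (rMinus M a Λ + rPlus M a Λ + rCosmo M a Λ)) * (rPlus M a Λ - rMinus M a Λ) =
      (rPlus M a Λ - rMinus M a Λ) * (rMinus M a Λ + rPlus M a Λ + 2 * rCosmo M a Λ) by ring, hL, hxi]
  have h3 : rMinus M a Λ + rPlus M a Λ + 2 * rCosmo M a Λ ≠ 0 := by linarith
  have hL0 : kdsL2 (rMinus M a Λ) (rPlus M a Λ) (rCosmo M a Λ) a ≠ 0 := hLpos.ne'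
  rw [eq_div_iff (mul_ne_zero hL0 (mul_ne_zero h1 h3))]
  field_simp

/-- **CTdC's "One can verify", verified: `Im(ω̄ Ṽ(z)) > 0` on `(1, z₂)`.** On subextremal
Kerr–de Sitter with `a > 0`, for `Im ω > 0`, `Im(λ̄ ω̄) ≤ 0` and `|ω| ∉ |m|(0, Ω_SR)`
(`Ω_SR = superradiantUpper`), the printed potential (3.27) — with the (3.10) exponents
`η₀, η₁, η₂ = etaCauchy, etaEvent, etaCosmo`, the `λ̄`-block `ctdcLT`, the horizon radii
`r₀, r₁, r₂ = rMinus, rPlus, rCosmo` and ANY `z₂ > 1` — satisfies `Im(ω̄ Ṽ(z)) > 0` for all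
`z ∈ (1, z₂)`. (Printed: "the right hand side of (3.28) is non-negative for `z ∈ [1,z₂]` in the full
subextremal range of parameters".) [cite: CasalsTeixeiradacosta2022, Theorem 3.10 (proof, Step 2), (3.28)–(3.30)] -/
theorem im_conj_mul_ctdcTildeV_pos (hsub : IsSubextremal M a Λ) (ha : 0 < a) {ω : ℂ} {m : ℝ}
    {lamBar : ℂ} (hω : 0 < ω.im) (hlam : (lamBar * conj ω).im ≤ 0)
    (hwin : ¬(0 < ‖ω‖ ∧ ‖ω‖ < |m| * superradiantUpper M a Λ)) (s : ℝ) {z₂ : ℝ} (hz₂ : 1 < z₂)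
    {z : ℝ} (hz : z ∈ Ioo 1 z₂) :
    0 < (conj ω * ctdcTildeV s (etaCauchy M a Λ ω m) (etaEvent M a Λ ω m) (etaCosmo M a Λ ω m)
      (ctdcLT M a Λ ω m lamBar) z₂ (rMinus M a Λ) (rPlus M a Λ) (rCosmo M a Λ) z).im := by
  have ha' : a ≠ 0 := ha.ne'
  have h0 := rMinus_nonneg M a Λ
  have hcoef := ctdcLT_coeff_eq_kdsC hsub
  have hΩeq := superradiantUpper_eq_kdsOmega hsub
  rw [etaCauchy_eq_I_mul hsub ha', etaEvent_eq_I_mul hsub ha', etaCosmo_eq_I_mul hsub ha',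
    im_conj_mul_ctdcTildeV_eq s _ _ _ _ _ _ (kdsC (rMinus M a Λ) (rPlus M a Λ) (rCosmo M a Λ) a),
    im_conj_mul_ctdcLT]
  obtain ⟨hM, hΛ, h01, h12, -⟩ := hsub
  set x := rMinus M a Λ with hx
  set y := rPlus M a Λ with hy
  set zc := rCosmo M a Λ with hzc
  -- the three signed pieces
  have hp : 0 < ctdcP z₂ z := by
    unfold ctdcP; exact mul_pos (mul_pos (by linarith [hz.1]) (by linarith [hz.1])) (by linarith [hz.2])
  have hk₀ : 0 < 3 / Λ / ((zc + (x + y + zc)) * (y - x)) :=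
    div_pos (div_pos (by norm_num) hΛ) (mul_pos (by linarith) (by linarith))
  have hE : 0 ≤ ctdcTildeE s z₂ x y zc z := ctdcTildeE_nonneg h0 h01 h12 ⟨hz.1.le, hz.2.le⟩
  have hW : 0 < normSq ω := Complex.normSq_pos.2 (fun h => by rw [h] at hω; simp at hω)
  have hΩpos : 0 < kdsOmega x y zc a := by
    unfold kdsOmega; exact div_pos (by linarith) (kdsN_pos h0 h01 h12)
  have hWμ : m ^ 2 * kdsOmega x y zc a ^ 2 ≤ normSq ω := by
    have hnorm : 0 < ‖ω‖ := by
      rw [norm_pos_iff]; intro h; rw [h] at hω; simp at hω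
    have hle : |m| * kdsOmega x y zc a ≤ ‖ω‖ := by
      by_contra hlt
      push Not at hlt
      exact hwin ⟨hnorm, by rw [hΩeq]; exact hlt⟩
    have hnn : 0 ≤ |m| * kdsOmega x y zc a := mul_nonneg (abs_nonneg m) hΩpos.le
    have hsq := mul_self_le_mul_self hnn hle
    rw [Complex.normSq_eq_norm_sq]
    nlinarith [sq_abs m]
  have hRHS := kds_tildeRHS_pos h0 h01 h12 ha hz₂ hW (sq_nonneg m) hWμ hz
  have hlam' : (conj ω * lamBar).im ≤ 0 := by rwa [mul_comm]
  -- assemble: `−p·k₀·(Im(ω̄λ̄) + Ξ²a²W Im ω) + Im ω (E + p c W + z·RHS)` with `k₀Ξ²a² = c`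
  have e1 : -(ctdcP z₂ z * (3 / Λ / ((zc + (x + y + zc)) * (y - x)) *
      ((conj ω * lamBar).im + xi a Λ ^ 2 * a ^ 2 * normSq ω * ω.im))) +
      ω.im * (ctdcTildeE s z₂ x y zc z + ctdcP z₂ z * kdsC x y zc a * normSq ω +
        z * (normSq ω * tildeA (kdsW₀ x y zc a) (kdsW₁ x y zc a) (kdsW₂ x y zc a) (kdsC x y zc a) z₂ z -
          m ^ 2 * tildeB (kdsW₀ x y zc a) (kdsW₁ x y zc a) (kdsW₂ x y zc a) (horizonAngVel a x)
            (horizonAngVel a y) (horizonAngVel a zc) z₂ z)) =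
      -(ctdcP z₂ z * (3 / Λ / ((zc + (x + y + zc)) * (y - x))) * (conj ω * lamBar).im) +
      ω.im * (ctdcTildeE s z₂ x y zc z +
        z * (normSq ω * tildeA (kdsW₀ x y zc a) (kdsW₁ x y zc a) (kdsW₂ x y zc a) (kdsC x y zc a) z₂ z -
          m ^ 2 * tildeB (kdsW₀ x y zc a) (kdsW₁ x y zc a) (kdsW₂ x y zc a) (horizonAngVel a x)
            (horizonAngVel a y) (horizonAngVel a zc) z₂ z)) := by
    rw [← hcoef]; ring
  rw [e1]
  have t1 : 0 ≤ -(ctdcP z₂ z * (3 / Λ / ((zc + (x + y + zc)) * (y - x))) * (conj ω * lamBar).im) := by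
    have := mul_nonneg (mul_pos hp hk₀).le (neg_nonneg.2 hlam')
    linarith
  have t2 : 0 < ω.im * (ctdcTildeE s z₂ x y zc z +
      z * (normSq ω * tildeA (kdsW₀ x y zc a) (kdsW₁ x y zc a) (kdsW₂ x y zc a) (kdsC x y zc a) z₂ z -
        m ^ 2 * tildeB (kdsW₀ x y zc a) (kdsW₁ x y zc a) (kdsW₂ x y zc a) (horizonAngVel a x)
          (horizonAngVel a y) (horizonAngVel a zc) z₂ z)) :=
    mul_pos hω (add_pos_of_nonneg_of_pos hE (mul_pos (by linarith [hz.1]) hRHS))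
  linarith

end Instantiation

/-! ### Step 2 itself: the boundary-flux argument for the transformed equation -/

section Flux

/-- The transformed ODE in `Ṽ`-form: `R̃` is `C²` on `(1, z₂)` and `p² R̃″ + (Ṽ − ½pp″ + ¼p′²) R̃ = 0`
there (`p = z(z−1)(z₂−z)`); this is `ũ'' + Ṽũ = 0` for `ũ = p^{−1/2}R̃`, `d/dz* = p d/dz`, and it is the
normal form `z(z−1)(z−z₂)R̃″ + C̃R̃ = 0` of (3.25) for any `C̃` with `−pC̃ + ½pp″ − ¼p′² = Ṽ`
(`isTildeSolution_of_normalForm`). [cite: CasalsTeixeiradacosta2022, (3.25) and (3.27)] -/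
def IsTildeSolution (V : ℝ → ℂ) (z₂ : ℝ) (R : ℝ → ℂ) : Prop :=
  ∃ R' R'' : ℝ → ℂ, ∀ z ∈ Ioo 1 z₂,
    HasDerivAt R (R' z) z ∧ HasDerivAt R' (R'' z) z ∧
      ((ctdcP z₂ z : ℝ) : ℂ) ^ 2 * R'' z +
          (V z - ((ctdcP z₂ z * ctdcPDD z₂ z / 2 - ctdcPD z₂ z ^ 2 / 4 : ℝ) : ℂ)) * R z = 0

/-- From the normal form (3.25) to the `Ṽ`-form: if `z(z−1)(z−z₂)R̃″ + C̃R̃ = 0` on `(1,z₂)` and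
`p·C̃ = −Ṽ + ½pp″ − ¼p′²` there, then `IsTildeSolution Ṽ z₂ R̃`.
[cite: CasalsTeixeiradacosta2022, (3.25) and (3.27)] -/
theorem isTildeSolution_of_normalForm {V C : ℝ → ℂ} {z₂ : ℝ} {R R' R'' : ℝ → ℂ}
    (hode : ∀ z ∈ Ioo 1 z₂, HasDerivAt R (R' z) z ∧ HasDerivAt R' (R'' z) z ∧
      ((z * (z - 1) * (z - z₂) : ℝ) : ℂ) * R'' z + C z * R z = 0)
    (hC : ∀ z ∈ Ioo 1 z₂, (ctdcP z₂ z : ℂ) * C z =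
      -V z + ((ctdcP z₂ z * ctdcPDD z₂ z / 2 - ctdcPD z₂ z ^ 2 / 4 : ℝ) : ℂ)) :
    IsTildeSolution V z₂ R := by
  refine ⟨R', R'', fun z hz => ⟨(hode z hz).1, (hode z hz).2.1, ?_⟩⟩
  have h := (hode z hz).2.2
  have hc := hC z hz
  have e : ((z * (z - 1) * (z - z₂) : ℝ) : ℂ) = -(ctdcP z₂ z : ℂ) := by
    unfold ctdcP; push_cast; ring
  rw [e] at h
  linear_combination (-(ctdcP z₂ z : ℂ)) * h + R z * hc

/-- `p' ` is the derivative of `p`. [cite: CasalsTeixeiradacosta2022, Theorem 3.10 (proof, Step 2)] -/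
theorem hasDerivAt_ctdcP (z₂ z : ℝ) : HasDerivAt (fun x => ctdcP z₂ x) (ctdcPD z₂ z) z := by
  have h := ((hasDerivAt_id z).mul ((hasDerivAt_id z).sub_const 1)).mul
    ((hasDerivAt_const z z₂).sub (hasDerivAt_id z))
  have e : ctdcPD z₂ z = (1 * (id z - 1) + id z * 1) * (z₂ - id z) + id z * (id z - 1) * (0 - 1) := by
    unfold ctdcPD; simp only [id]; ring
  rw [e]
  exact h.congr_of_eventuallyEq (Filter.Eventually.of_forall fun x => by unfold ctdcP; simp [id])

/-- `p″` is the derivative of `p′`. [cite: CasalsTeixeiradacosta2022, Theorem 3.10 (proof, Step 2)] -/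
theorem hasDerivAt_ctdcPD (z₂ z : ℝ) : HasDerivAt (fun x => ctdcPD z₂ x) (ctdcPDD z₂ z) z := by
  have h := (((hasDerivAt_pow 2 z).const_mul (-3)).add
    ((hasDerivAt_id z).const_mul (2 * (1 + z₂)))).sub_const z₂
  have e : ctdcPDD z₂ z = -3 * (↑2 * z ^ (2 - 1)) + 2 * (1 + z₂) * 1 := by
    unfold ctdcPDD; norm_num; ring
  rw [e]
  exact h.congr_of_eventuallyEq (Filter.Eventually.of_forall fun x => by
    unfold ctdcPD
    simp only [Pi.add_apply, id])

/-- The algebra of `−(Q^T)′` (3.29): with `R̃″ = −(Ṽ − L)R̃/p²`, `L = ½pp″ − ¼p′²`, `k = p′/(2p)`,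
`k′ = (p″p − p′²)/(2p²)`, the derivative of `ω̄R̃′R̃̄ + i·Im ω·k|R̃|²` has imaginary part
`−Im ω |R̃′ − kR̃|² − |R̃|² Im(ω̄Ṽ)/p²` (uses `k′ + k² = L/p²`).
[cite: CasalsTeixeiradacosta2022, Theorem 3.10 (proof, Step 2), (3.29)] -/
theorem tildeFlux_deriv_im (c V R R₁ : ℂ) {p : ℝ} (pd pdd : ℝ) (hp : p ≠ 0) :
    (conj c * (-(V - ((p * pdd / 2 - pd ^ 2 / 4 : ℝ) : ℂ)) * R / ((p : ℂ) ^ 2) * conj R +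
        R₁ * conj R₁) +
      I * ((c.im * ((pdd * p - pd ^ 2) / (2 * p ^ 2)) : ℝ) : ℂ) * (R * conj R) +
      I * ((c.im * (pd / (2 * p)) : ℝ) : ℂ) * (R₁ * conj R + R * conj R₁)).im =
      -(c.im * normSq (R₁ - ((pd / (2 * p) : ℝ) : ℂ) * R)) - normSq R * (conj c * V).im / p ^ 2 := by
  have hp2 : (p : ℂ) ^ 2 ≠ 0 := pow_ne_zero 2 (by exact_mod_cast hp)
  have e : ((p : ℂ) ^ 2)⁻¹ = (((p ^ 2)⁻¹ : ℝ) : ℂ) := by push_cast; ring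
  rw [div_eq_mul_inv, e]
  simp only [mul_im, mul_re, add_im, add_re, sub_im, sub_re, neg_im, neg_re, ofReal_re, ofReal_im,
    conj_re, conj_im, I_re, I_im, normSq_apply]
  field_simp
  ring

/-- **Endpoint behaviour of a branch `S = u^q g` with `Re q > ½`** (`u` affine, `u(x₀) = 0`, `u > 0`
on the side `J`, `g` smooth near `x₀`): `S′·S̄ → 0` and `|S|²/u → 0` as `x → x₀` within `J`
(`S′S̄ = u^{2Re q−1}(q c|g|² + u g′ḡ)`, `|S|²/u = u^{2Re q−1}|g|²`). The vanishing of the boundary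
terms `Q^T[ũ](±∞)` for `Im ω > 0` under (3.26). [cite: CasalsTeixeiradacosta2022, Theorem 3.10 (proof, Step 2)] -/
theorem tendsto_flux_of_cpowBranch_half
    {U J : Set ℝ} {x₀ : ℝ} (hU : IsOpen U) (hx₀ : x₀ ∈ U) (hJ : IsOpen J) (hJU : J ⊆ U)
    {g : ℝ → ℂ} (hg : ContDiffOn ℝ ((⊤ : ℕ∞) : WithTop ℕ∞) g U)
    {u : ℝ → ℝ} {c : ℝ} (hu : ∀ x, HasDerivAt u c x) (hu0 : u x₀ = 0) (hupos : ∀ x ∈ J, 0 < u x)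
    {q : ℂ} (hq : 1 / 2 < q.re) {S S' : ℝ → ℂ} (hS : ∀ x ∈ J, HasDerivAt S (S' x) x)
    (hSg : ∀ x ∈ J, S x = ((u x : ℝ) : ℂ) ^ q * g x) :
    Tendsto (fun x => S' x * conj (S x)) (𝓝[J] x₀) (𝓝 0) ∧
      Tendsto (fun x => normSq (S x) / u x) (𝓝[J] x₀) (𝓝 0) := by
  have h1 : (1 : WithTop ℕ∞) ≤ ((⊤ : ℕ∞) : WithTop ℕ∞) := by exact_mod_cast le_top
  have h0 : ((⊤ : ℕ∞) : WithTop ℕ∞) ≠ 0 := by simp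
  have hgd : DifferentiableOn ℝ g U := hg.differentiableOn h0
  have hgc : ContinuousAt g x₀ :=
    (hgd.continuousOn.continuousWithinAt hx₀).continuousAt (hU.mem_nhds hx₀)
  have hg'c : ContinuousAt (deriv g) x₀ :=
    ((hg.continuousOn_deriv_of_isOpen hU h1).continuousWithinAt hx₀).continuousAt (hU.mem_nhds hx₀)
  -- the derivative of `S` on `J`
  have hS' : ∀ x ∈ J, S' x = q * ((u x : ℝ) : ℂ) ^ (q - 1) * (c : ℂ) * g x +
      ((u x : ℝ) : ℂ) ^ q * deriv g x := by
    intro x hx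
    have hgx : HasDerivAt g (deriv g x) x :=
      ((hgd x (hJU hx)).differentiableAt (hU.mem_nhds (hJU hx))).hasDerivAt
    have hux : HasDerivAt (fun y => ((u y : ℝ) : ℂ)) (c : ℂ) x := (hu x).ofReal_comp
    have hslit : ((u x : ℝ) : ℂ) ∈ slitPlane := Complex.ofReal_mem_slitPlane.2 (hupos x hx)
    have hpow' : HasDerivAt ((fun w : ℂ => w ^ q) ∘ fun y => ((u y : ℝ) : ℂ))
        (q * ((u x : ℝ) : ℂ) ^ (q - 1) * (c : ℂ)) x :=
      (Complex.hasStrictDerivAt_cpow_const (c := q) hslit).hasDerivAt.comp x hux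
    have hpow : HasDerivAt (fun y => ((u y : ℝ) : ℂ) ^ q) (q * ((u x : ℝ) : ℂ) ^ (q - 1) * (c : ℂ)) x := by
      simpa only [Function.comp_def] using hpow'
    have hprod := hpow.mul hgx
    have heq : S =ᶠ[𝓝 x] fun y => ((u y : ℝ) : ℂ) ^ q * g y :=
      Filter.eventually_of_mem (hJ.mem_nhds hx) fun y hy => hSg y hy
    exact (hS x hx).unique (hprod.congr_of_eventuallyEq heq)
  -- the two identities on `J`, with `A = u^{2Re q − 1}`
  have hid : ∀ x ∈ J,
      S' x * conj (S x) = (((u x) ^ (2 * q.re - 1) : ℝ) : ℂ) * (q * (c : ℂ) * (g x * conj (g x))) +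
        (((u x * (u x) ^ (2 * q.re - 1)) : ℝ) : ℂ) * (deriv g x * conj (g x)) ∧
      normSq (S x) / u x = (u x) ^ (2 * q.re - 1) * normSq (g x) := by
    intro x hx
    have hU0 : 0 < u x := hupos x hx
    have hne : ((u x : ℝ) : ℂ) ≠ 0 := by exact_mod_cast hU0.ne'
    set P : ℂ := ((u x : ℝ) : ℂ) ^ q with hP
    have e1 : ((u x : ℝ) : ℂ) * ((u x : ℝ) : ℂ) ^ (q - 1) = P := by
      rw [hP, cpow_sub _ _ hne, cpow_one]
      field_simp
    have ePP : P * conj P = ((((u x) ^ q.re) ^ 2 : ℝ) : ℂ) := by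
      rw [hP, Complex.mul_conj, Complex.normSq_eq_norm_sq, Complex.norm_cpow_eq_rpow_re_of_pos hU0]
    have eA : ((u x) ^ q.re) ^ 2 = u x * (u x) ^ (2 * q.re - 1) := by
      rw [← Real.rpow_natCast ((u x) ^ q.re) 2, ← Real.rpow_mul hU0.le]
      rw [show q.re * ((2 : ℕ) : ℝ) = (2 * q.re - 1) + 1 by push_cast; ring,
        Real.rpow_add hU0, Real.rpow_one]
      ring
    have e2 : P * conj P = ((u x : ℝ) : ℂ) * (((u x) ^ (2 * q.re - 1) : ℝ) : ℂ) := by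
      rw [ePP, eA]; push_cast; ring
    refine ⟨?_, ?_⟩
    · have hmain : ((u x : ℝ) : ℂ) * (S' x * conj (S x)) =
          ((u x : ℝ) : ℂ) * ((((u x) ^ (2 * q.re - 1) : ℝ) : ℂ) * (q * (c : ℂ) * (g x * conj (g x))) +
            (((u x * (u x) ^ (2 * q.re - 1)) : ℝ) : ℂ) * (deriv g x * conj (g x))) := by
        rw [hS' x hx, hSg x hx, map_mul, ← hP]
        push_cast
        linear_combination (q * (c : ℂ) * g x * conj (g x) * conj P) * e1 +
          (q * (c : ℂ) * (g x * conj (g x)) + ((u x : ℝ) : ℂ) * (deriv g x * conj (g x))) * e2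
      exact mul_left_cancel₀ hne hmain
    · have hS2 : normSq (S x) = ((u x) ^ q.re) ^ 2 * normSq (g x) := by
        rw [hSg x hx, map_mul, ← hP, Complex.normSq_eq_norm_sq P, hP,
          Complex.norm_cpow_eq_rpow_re_of_pos hU0]
      rw [hS2, eA]
      field_simp
  -- limits of the model expressions
  have hu_t : Tendsto u (𝓝 x₀) (𝓝 0) := by
    simpa [hu0] using (hu x₀).continuousAt.tendsto
  have hexp : 0 < 2 * q.re - 1 := by linarith
  have tA : Tendsto (fun x => (u x) ^ (2 * q.re - 1)) (𝓝 x₀) (𝓝 0) :=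
    hu_t.rpow_const_nhds_zero hexp
  have tuA : Tendsto (fun x => u x * (u x) ^ (2 * q.re - 1)) (𝓝 x₀) (𝓝 0) := by
    simpa using hu_t.mul tA
  have t3 : Tendsto g (𝓝 x₀) (𝓝 (g x₀)) := hgc.tendsto
  have t3c : Tendsto (fun x => conj (g x)) (𝓝 x₀) (𝓝 (conj (g x₀))) :=
    (Complex.continuous_conj.tendsto _).comp t3
  have t4 : Tendsto (deriv g) (𝓝 x₀) (𝓝 (deriv g x₀)) := hg'c.tendsto
  refine ⟨?_, ?_⟩
  · have tM : Tendsto (fun x => (((u x) ^ (2 * q.re - 1) : ℝ) : ℂ) * (q * (c : ℂ) * (g x * conj (g x))) +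
        (((u x * (u x) ^ (2 * q.re - 1)) : ℝ) : ℂ) * (deriv g x * conj (g x))) (𝓝 x₀) (𝓝 0) := by
      have := (tA.ofReal.mul ((t3.mul t3c).const_mul (q * (c : ℂ)))).add (tuA.ofReal.mul (t4.mul t3c))
      simpa only [Complex.ofReal_zero, zero_mul, zero_add] using this
    refine (tM.mono_left nhdsWithin_le_nhds).congr' ?_
    filter_upwards [self_mem_nhdsWithin] with x hx
    exact ((hid x hx).1).symm
  · have tM : Tendsto (fun x => (u x) ^ (2 * q.re - 1) * normSq (g x)) (𝓝 x₀) (𝓝 0) := by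
      have := tA.mul ((Complex.continuous_normSq.tendsto _).comp t3)
      simpa [Function.comp_def] using this
    refine (tM.mono_left nhdsWithin_le_nhds).congr' ?_
    filter_upwards [self_mem_nhdsWithin] with x hx
    exact ((hid x hx).2).symm

/-- **Step 2, abstract form: a growing-frequency solution of `ũ'' + Ṽũ = 0` with sign-definite
`Im(ω̄Ṽ)` and subcritical endpoint branches vanishes.** Let `Im ω > 0`, `Im(ω̄ V(z)) > 0` on
`(1, z₂)`, and let `R̃` solve `p²R̃″ + (V − ½pp″ + ¼p′²)R̃ = 0` on `(1, z₂)` with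
`R̃ = (z−1)^{q₁}·g₁` near `1⁺`, `R̃ = (z₂−z)^{q₂}·g₂` near `z₂⁻`, `g_i` smooth, `Re q_i > ½`. Then
`R̃ ≡ 0` on `(1,z₂)`: the flux `F = Im(ω̄R̃′R̃̄) + (Im ω/2)(p′/p)|R̃|²` (`= Q^T[ũ]`) is non-increasing with
`F′ = −Im ω|R̃′ − (p′/2p)R̃|² − |R̃|²Im(ω̄V)/p²`, strictly somewhere unless `R̃ ≡ 0`, and tends to `0`
at both ends. [cite: CasalsTeixeiradacosta2022, Theorem 3.10 (proof, Step 2), (3.29)] -/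
theorem tildeSolution_eq_zero_of_pos {V : ℝ → ℂ} {z₂ : ℝ} (hz₂ : 1 < z₂) {ω : ℂ} (hω : 0 < ω.im)
    (hV : ∀ z ∈ Ioo 1 z₂, 0 < (conj ω * V z).im) {q₁ q₂ : ℂ} (hq₁ : 1 / 2 < q₁.re)
    (hq₂ : 1 / 2 < q₂.re) {R : ℝ → ℂ} (hR : IsTildeSolution V z₂ R)
    (h1 : ∃ ε : ℝ, 0 < ε ∧ ∃ g : ℝ → ℂ, ContDiffOn ℝ ((⊤ : ℕ∞) : WithTop ℕ∞) g (Ioo (1 - ε) (1 + ε)) ∧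
      ∀ z ∈ Ioo 1 (1 + ε), R z * ((z - 1 : ℝ) : ℂ) ^ (-q₁) = g z)
    (h2 : ∃ ε : ℝ, 0 < ε ∧ ∃ g : ℝ → ℂ, ContDiffOn ℝ ((⊤ : ℕ∞) : WithTop ℕ∞) g (Ioo (z₂ - ε) (z₂ + ε)) ∧
      ∀ z ∈ Ioo (z₂ - ε) z₂, R z * ((z₂ - z : ℝ) : ℂ) ^ (-q₂) = g z) :
    ∀ z ∈ Ioo 1 z₂, R z = 0 := by
  by_contra hcon
  push Not at hcon
  obtain ⟨z₀, hz₀, hR₀⟩ := hcon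
  obtain ⟨R', R'', hode⟩ := hR
  have hp : ∀ z ∈ Ioo 1 z₂, 0 < ctdcP z₂ z := fun z hz => by
    unfold ctdcP; exact mul_pos (mul_pos (by linarith [hz.1]) (by linarith [hz.1])) (by linarith [hz.2])
  -- the flux and its derivative
  set k : ℝ → ℝ := fun z => ctdcPD z₂ z / (2 * ctdcP z₂ z) with hk
  set k' : ℝ → ℝ := fun z => (ctdcPDD z₂ z * ctdcP z₂ z - ctdcPD z₂ z ^ 2) / (2 * ctdcP z₂ z ^ 2)
    with hk'
  set E : ℝ → ℂ := fun z => conj ω * (R' z * conj (R z)) +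
    I * ((ω.im * k z : ℝ) : ℂ) * (R z * conj (R z)) with hE
  refine false_of_antitone_flux_Ioo (lo := 1) (hi := z₂) (G := fun z => (E z).im)
    (G' := fun z => -(ω.im * normSq (R' z - ((ctdcPD z₂ z / (2 * ctdcP z₂ z) : ℝ) : ℂ) * R z)) -
      normSq (R z) * (conj ω * V z).im / ctdcP z₂ z ^ 2) ?_ ?_ ?_ ?_ ?_
  · -- differentiability of the flux, with the closed form of its derivative
    intro z hz
    obtain ⟨hd1, hd2, heq⟩ := hode z hz
    have hpz := (hp z hz).ne'
    have hRbar : HasDerivAt (fun y => conj (R y)) (conj (R' z)) z := by simpa using hd1.star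
    have hR'bar : HasDerivAt (fun y => conj (R' y)) (conj (R'' z)) z := by simpa using hd2.star
    have hkd : HasDerivAt k (k' z) z := by
      have h := (hasDerivAt_ctdcPD z₂ z).div ((hasDerivAt_ctdcP z₂ z).const_mul 2)
        (mul_ne_zero two_ne_zero hpz)
      have e : k' z = (ctdcPDD z₂ z * (2 * ctdcP z₂ z) - ctdcPD z₂ z * (2 * ctdcPD z₂ z)) /
          (2 * ctdcP z₂ z) ^ 2 := by
        rw [hk']
        rw [div_eq_div_iff (mul_ne_zero two_ne_zero (pow_ne_zero 2 hpz))
          (pow_ne_zero 2 (mul_ne_zero two_ne_zero hpz))]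
        ring
      rw [e]
      exact h
    have hkc : HasDerivAt (fun y => ((ω.im * k y : ℝ) : ℂ)) (((ω.im * k' z : ℝ) : ℂ)) z := by
      exact (hkd.const_mul ω.im).ofReal_comp
    have hEd : HasDerivAt E
        (conj ω * (R'' z * conj (R z) + R' z * conj (R' z)) +
          (I * ((ω.im * k' z : ℝ) : ℂ) * (R z * conj (R z)) +
            I * ((ω.im * k z : ℝ) : ℂ) * (R' z * conj (R z) + R z * conj (R' z)))) z := by
      have t1 := (hd2.mul hRbar).const_mul (conj ω)
      have t2 := (hkc.const_mul I).mul (hd1.mul hRbar)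
      have := t1.add t2
      refine this.congr_deriv ?_
      simp only [Pi.mul_apply]
    -- substitute the ODE: `R'' = −(V − L)R/p²`
    have hp2 : ((ctdcP z₂ z : ℝ) : ℂ) ^ 2 ≠ 0 := pow_ne_zero 2 (by exact_mod_cast hpz)
    have hR'' : R'' z = -(V z - ((ctdcP z₂ z * ctdcPDD z₂ z / 2 - ctdcPD z₂ z ^ 2 / 4 : ℝ) : ℂ)) *
        R z / ((ctdcP z₂ z : ℂ) ^ 2) := by
      rw [eq_div_iff hp2]
      linear_combination heq
    have hval := tildeFlux_deriv_im ω (V z) (R z) (R' z) (ctdcPD z₂ z) (ctdcPDD z₂ z) hpz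
    have hEd' : HasDerivAt E
        (conj ω * (-(V z - ((ctdcP z₂ z * ctdcPDD z₂ z / 2 - ctdcPD z₂ z ^ 2 / 4 : ℝ) : ℂ)) *
            R z / ((ctdcP z₂ z : ℂ) ^ 2) * conj (R z) + R' z * conj (R' z)) +
          I * ((ω.im * ((ctdcPDD z₂ z * ctdcP z₂ z - ctdcPD z₂ z ^ 2) / (2 * ctdcP z₂ z ^ 2)) : ℝ) : ℂ) *
            (R z * conj (R z)) +
          I * ((ω.im * (ctdcPD z₂ z / (2 * ctdcP z₂ z)) : ℝ) : ℂ) *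
            (R' z * conj (R z) + R z * conj (R' z))) z := by
      refine hEd.congr_deriv ?_
      rw [hR'']
      simp only [hk, hk']
      ring
    have hG := Complex.imCLM.hasFDerivAt.comp_hasDerivAt z hEd'
    simp only [Function.comp_def, Complex.imCLM_apply] at hG
    rw [hval] at hG
    exact hG
  · -- `G' ≤ 0`
    intro z hz
    have t1 : 0 ≤ ω.im * normSq (R' z - ((ctdcPD z₂ z / (2 * ctdcP z₂ z) : ℝ) : ℂ) * R z) :=
      mul_nonneg hω.le (normSq_nonneg _)
    have t2 : 0 ≤ normSq (R z) * (conj ω * V z).im / ctdcP z₂ z ^ 2 :=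
      div_nonneg (mul_nonneg (normSq_nonneg _) (hV z hz).le) (sq_nonneg _)
    show -(ω.im * normSq (R' z - ((ctdcPD z₂ z / (2 * ctdcP z₂ z) : ℝ) : ℂ) * R z)) -
      normSq (R z) * (conj ω * V z).im / ctdcP z₂ z ^ 2 ≤ 0
    linarith
  · -- `G' z₀ < 0`
    refine ⟨z₀, hz₀, ?_⟩
    have t1 : 0 ≤ ω.im * normSq (R' z₀ - ((ctdcPD z₂ z₀ / (2 * ctdcP z₂ z₀) : ℝ) : ℂ) * R z₀) :=
      mul_nonneg hω.le (normSq_nonneg _)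
    have t2 : 0 < normSq (R z₀) * (conj ω * V z₀).im / ctdcP z₂ z₀ ^ 2 :=
      div_pos (mul_pos (Complex.normSq_pos.mpr hR₀) (hV z₀ hz₀)) (pow_pos (hp z₀ hz₀) 2)
    show -(ω.im * normSq (R' z₀ - ((ctdcPD z₂ z₀ / (2 * ctdcP z₂ z₀) : ℝ) : ℂ) * R z₀)) -
      normSq (R z₀) * (conj ω * V z₀).im / ctdcP z₂ z₀ ^ 2 < 0
    linarith
  · -- `G → 0` at `z = 1⁺`: branch `(z−1)^{q₁}`, `Re q₁ > 1/2`
    obtain ⟨ε, hε, g, hg, hRg⟩ := h1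
    have hb : (1 : ℝ) < min (1 + ε) z₂ := lt_min (by linarith) hz₂
    have hJsub : Ioo 1 (min (1 + ε) z₂) ⊆ Ioo (1 - ε) (1 + ε) := fun x hx =>
      ⟨by linarith [hx.1], lt_of_lt_of_le hx.2 (min_le_left _ _)⟩
    have hJI : Ioo 1 (min (1 + ε) z₂) ⊆ Ioo 1 z₂ := fun x hx =>
      ⟨hx.1, lt_of_lt_of_le hx.2 (min_le_right _ _)⟩
    have hlim := tendsto_flux_of_cpowBranch_half (x₀ := 1) (U := Ioo (1 - ε) (1 + ε))
      (J := Ioo 1 (min (1 + ε) z₂)) isOpen_Ioo ⟨by linarith, by linarith⟩ isOpen_Ioo hJsub hg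
      (u := fun x => x - 1) (c := 1) (fun x => (hasDerivAt_id' x).sub_const _) (by simp)
      (fun x hx => by simp only [sub_pos]; exact hx.1) hq₁ (S := R) (S' := R')
      (fun x hx => (hode x (hJI hx)).1)
      (fun x hx => by
        have hx0 : (0 : ℝ) < x - 1 := by linarith [hx.1]
        have hne : ((x - 1 : ℝ) : ℂ) ≠ 0 := by exact_mod_cast hx0.ne'
        have h := hRg x ⟨hx.1, lt_of_lt_of_le hx.2 (min_le_left _ _)⟩
        have hpow : ((x - 1 : ℝ) : ℂ) ^ q₁ ≠ 0 := by
          rw [Ne, cpow_eq_zero_iff, not_and_or]; exact Or.inl hne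
        rw [cpow_neg] at h
        rw [← h, mul_comm (R x) _, ← mul_assoc, mul_inv_cancel₀ hpow, one_mul])
    obtain ⟨hT1, hT2⟩ := hlim
    -- `p'/(2 z (z₂ − z))` is continuous at `1`
    have hmc : ContinuousAt (fun x : ℝ => ctdcPD z₂ x / (2 * (x * (z₂ - x)))) 1 := by
      have hne : (2 * ((1 : ℝ) * (z₂ - 1))) ≠ 0 := by positivity
      unfold ctdcPD
      exact (by fun_prop : Continuous fun x : ℝ => -3 * x ^ 2 + 2 * (1 + z₂) * x - z₂).continuousAt.div
        (by fun_prop : Continuous fun x : ℝ => 2 * (x * (z₂ - x))).continuousAt hne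
    have hm : Tendsto (fun x : ℝ => ctdcPD z₂ x / (2 * (x * (z₂ - x))))
        (𝓝[Ioo 1 (min (1 + ε) z₂)] 1) (𝓝 (ctdcPD z₂ 1 / (2 * (1 * (z₂ - 1))))) :=
      hmc.tendsto.mono_left nhdsWithin_le_nhds
    have t := (hT1.const_mul (conj ω)).add (((hm.mul hT2).const_mul ω.im).ofReal.const_mul I)
    simp only [mul_zero, Complex.ofReal_zero, add_zero] at t
    have hlimE := (Complex.continuous_im.tendsto (0 : ℂ)).comp t
    simp only [Complex.zero_im] at hlimE
    rw [nhdsWithin_Ioo_eq_nhdsGT hb] at hlimE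
    refine hlimE.congr' ?_
    filter_upwards [Ioo_mem_nhdsGT hb] with x hx
    have hx1 : x - 1 ≠ 0 := by linarith [hx.1]
    have hxz : x * (z₂ - x) ≠ 0 :=
      mul_ne_zero (by linarith [hx.1]) (by linarith [lt_of_lt_of_le hx.2 (min_le_right _ _)])
    have e : ctdcPD z₂ x / (2 * (x * (z₂ - x))) * (normSq (R x) / (x - 1)) = k x * normSq (R x) := by
      simp only [hk]; unfold ctdcP; field_simp
    show (conj ω * (R' x * conj (R x)) +
        I * (((ω.im * (ctdcPD z₂ x / (2 * (x * (z₂ - x))) * (normSq (R x) / (x - 1)))) : ℝ) : ℂ)).im =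
      (conj ω * (R' x * conj (R x)) + I * ((ω.im * k x : ℝ) : ℂ) * (R x * conj (R x))).im
    rw [e, Complex.mul_conj]
    push_cast
    ring
  · -- `G → 0` at `z = z₂⁻`: branch `(z₂−z)^{q₂}`, `Re q₂ > 1/2`
    obtain ⟨ε, hε, g, hg, hRg⟩ := h2
    have hb : max (z₂ - ε) 1 < z₂ := max_lt (by linarith) hz₂
    have hJsub : Ioo (max (z₂ - ε) 1) z₂ ⊆ Ioo (z₂ - ε) (z₂ + ε) := fun x hx =>
      ⟨lt_of_le_of_lt (le_max_left _ _) hx.1, by linarith [hx.2]⟩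
    have hJI : Ioo (max (z₂ - ε) 1) z₂ ⊆ Ioo 1 z₂ := fun x hx =>
      ⟨lt_of_le_of_lt (le_max_right _ _) hx.1, hx.2⟩
    have hlim := tendsto_flux_of_cpowBranch_half (x₀ := z₂) (U := Ioo (z₂ - ε) (z₂ + ε))
      (J := Ioo (max (z₂ - ε) 1) z₂) isOpen_Ioo ⟨by linarith, by linarith⟩ isOpen_Ioo hJsub hg
      (u := fun x => z₂ - x) (c := -1) (fun x => (hasDerivAt_id' x).const_sub _) (by simp)
      (fun x hx => by simp only [sub_pos]; exact hx.2) hq₂ (S := R) (S' := R')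
      (fun x hx => (hode x (hJI hx)).1)
      (fun x hx => by
        have hx0 : (0 : ℝ) < z₂ - x := by linarith [hx.2]
        have hne : ((z₂ - x : ℝ) : ℂ) ≠ 0 := by exact_mod_cast hx0.ne'
        have h := hRg x ⟨lt_of_le_of_lt (le_max_left _ _) hx.1, hx.2⟩
        have hpow : ((z₂ - x : ℝ) : ℂ) ^ q₂ ≠ 0 := by
          rw [Ne, cpow_eq_zero_iff, not_and_or]; exact Or.inl hne
        rw [cpow_neg] at h
        rw [← h, mul_comm (R x) _, ← mul_assoc, mul_inv_cancel₀ hpow, one_mul])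
    obtain ⟨hT1, hT2⟩ := hlim
    have hmc : ContinuousAt (fun x : ℝ => ctdcPD z₂ x / (2 * (x * (x - 1)))) z₂ := by
      have hne : (2 * (z₂ * (z₂ - 1))) ≠ 0 := by
        have : 0 < z₂ * (z₂ - 1) := mul_pos (by linarith) (by linarith)
        positivity
      unfold ctdcPD
      exact (by fun_prop : Continuous fun x : ℝ => -3 * x ^ 2 + 2 * (1 + z₂) * x - z₂).continuousAt.div
        (by fun_prop : Continuous fun x : ℝ => 2 * (x * (x - 1))).continuousAt hne
    have hm : Tendsto (fun x : ℝ => ctdcPD z₂ x / (2 * (x * (x - 1))))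
        (𝓝[Ioo (max (z₂ - ε) 1) z₂] z₂) (𝓝 (ctdcPD z₂ z₂ / (2 * (z₂ * (z₂ - 1))))) :=
      hmc.tendsto.mono_left nhdsWithin_le_nhds
    have t := (hT1.const_mul (conj ω)).add (((hm.mul hT2).const_mul ω.im).ofReal.const_mul I)
    simp only [mul_zero, Complex.ofReal_zero, add_zero] at t
    have hlimE := (Complex.continuous_im.tendsto (0 : ℂ)).comp t
    simp only [Complex.zero_im] at hlimE
    rw [nhdsWithin_Ioo_eq_nhdsLT hb] at hlimE
    refine hlimE.congr' ?_
    filter_upwards [Ioo_mem_nhdsLT hb] with x hx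
    have hx1 : z₂ - x ≠ 0 := by linarith [hx.2]
    have hxz : x * (x - 1) ≠ 0 :=
      mul_ne_zero (by linarith [lt_of_le_of_lt (le_max_right _ _) hx.1])
        (by linarith [lt_of_le_of_lt (le_max_right _ _) hx.1])
    have e : ctdcPD z₂ x / (2 * (x * (x - 1))) * (normSq (R x) / (z₂ - x)) = k x * normSq (R x) := by
      simp only [hk]; unfold ctdcP; field_simp
    show (conj ω * (R' x * conj (R x)) +
        I * (((ω.im * (ctdcPD z₂ x / (2 * (x * (x - 1))) * (normSq (R x) / (z₂ - x)))) : ℝ) : ℂ)).im =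
      (conj ω * (R' x * conj (R x)) + I * ((ω.im * k x : ℝ) : ℂ) * (R x * conj (R x))).im
    rw [e, Complex.mul_conj]
    push_cast
    ring

end Flux

/-! ### Step 2 on subextremal Kerr–de Sitter: the transformed mode vanishes -/

section StepTwo

variable {M a Λ : ℝ}

/-- **(3.26) at the event horizon `z = 1`**: "`R̃(z)(z−1)^{−η₀−η₁−1/2}` smooth as `z → 1`" — `R̃`
times the principal power of the positive real `z − 1` agrees on some `(1, 1+ε)` with a function
`C^∞` on `(1−ε, 1+ε)`. [cite: CasalsTeixeiradacosta2022, Corollary 3.10 (3.26)] -/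
def IsTildeBranchAtOne (M a Λ : ℝ) (ω : ℂ) (m : ℝ) (R : ℝ → ℂ) : Prop :=
  ∃ ε : ℝ, 0 < ε ∧ ∃ g : ℝ → ℂ, ContDiffOn ℝ ((⊤ : ℕ∞) : WithTop ℕ∞) g (Ioo (1 - ε) (1 + ε)) ∧
    ∀ z ∈ Ioo 1 (1 + ε),
      R z * ((z - 1 : ℝ) : ℂ) ^ (-(etaCauchy M a Λ ω m + etaEvent M a Λ ω m + 1 / 2)) = g z

/-- **(3.26) at the cosmological horizon `z = z₂`**: "`R̃(z)(z−z₂)^{η₀+η₂−1/2}` smooth as `z → z₂`",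
with the positive base `z₂ − z` (constant factor absorbed in the smooth function, as in
`IsOutgoingAtCosmoHorizon`). [cite: CasalsTeixeiradacosta2022, Corollary 3.10 (3.26)] -/
def IsTildeBranchAtZ₂ (M a Λ : ℝ) (ω : ℂ) (m : ℝ) (z₂ : ℝ) (R : ℝ → ℂ) : Prop :=
  ∃ ε : ℝ, 0 < ε ∧ ∃ g : ℝ → ℂ, ContDiffOn ℝ ((⊤ : ℕ∞) : WithTop ℕ∞) g (Ioo (z₂ - ε) (z₂ + ε)) ∧
    ∀ z ∈ Ioo (z₂ - ε) z₂,
      R z * ((z₂ - z : ℝ) : ℂ) ^ (etaCauchy M a Λ ω m + etaCosmo M a Λ ω m - 1 / 2) = g z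

/-- `Re(η₀ + η₁ + ½) > ½` for `Im ω > 0` on subextremal Kerr–de Sitter with `a ≠ 0`
(`Re(η₀+η₁) = (Im ω/2)(1/κ₁ − 1/κ₀) > 0` since `κ₁ < κ₀`). [cite: CasalsTeixeiradacosta2022, (3.10) and proof of Corollary 3.9] -/
theorem re_exponent_one_gt_half (hsub : IsSubextremal M a Λ) (ha : a ≠ 0) {ω : ℂ} (hω : 0 < ω.im)
    (m : ℝ) : 1 / 2 < (etaCauchy M a Λ ω m + etaEvent M a Λ ω m + 1 / 2).re := by
  have hκ := surfaceGravity_rPlus_lt_rMinus hsub ha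
  have hκ1 := surfaceGravity_rPlus_pos hsub
  have hκ0 : 0 < surfaceGravity M a Λ (rMinus M a Λ) := hκ1.trans hκ
  simp only [add_re, etaCauchy_re, etaEvent_re]
  have h : ω.im / (2 * surfaceGravity M a Λ (rMinus M a Λ)) <
      ω.im / (2 * surfaceGravity M a Λ (rPlus M a Λ)) :=
    div_lt_div_of_pos_left hω (by positivity) (by linarith)
  have hre : ((1 : ℂ) / 2).re = 1 / 2 := by norm_num
  rw [hre]
  linarith

/-- `Re(½ − η₀ − η₂) > ½` for `Im ω > 0` (`Re η₀ = −Im ω/(2κ₀) < 0`, `Re η₂ = −Im ω/(2κ₂) < 0`).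
[cite: CasalsTeixeiradacosta2022, (3.10) and proof of Corollary 3.9] -/
theorem re_exponent_z₂_gt_half (hsub : IsSubextremal M a Λ) (ha : a ≠ 0) {ω : ℂ} (hω : 0 < ω.im)
    (m : ℝ) : 1 / 2 < (-(etaCauchy M a Λ ω m + etaCosmo M a Λ ω m - 1 / 2)).re := by
  have hκ0 := surfaceGravity_rMinus_pos hsub ha
  have hκ2 := surfaceGravity_rCosmo_pos hsub
  simp only [neg_re, sub_re, add_re, etaCauchy_re, etaCosmo_re]
  have h1 : 0 < ω.im / (2 * surfaceGravity M a Λ (rMinus M a Λ)) := div_pos hω (by positivity)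
  have h2 : 0 < ω.im / (2 * surfaceGravity M a Λ (rCosmo M a Λ)) := div_pos hω (by positivity)
  have hre : ((1 : ℂ) / 2).re = 1 / 2 := by norm_num
  rw [hre]
  linarith

/-- **Casals–Teixeira da Costa, proof of Theorem 3.10, Step 2 (`Im ω > 0`).** On subextremal
Kerr–de Sitter with `a > 0`: for `Im ω > 0`, `Im(λ̄ ω̄) ≤ 0` and `|ω| ∉ |m|(0, Ω_SR)`, every solution
`R̃` of the transformed radial equation in `Ṽ`-form (`p²R̃″ + (Ṽ − ½pp″ + ¼p′²)R̃ = 0` on `(1,z₂)`,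
`Ṽ = ctdcTildeV` = (3.27) with `η_j = etaCauchy, etaEvent, etaCosmo`, `LT = ctdcLT`,
`r_j = rMinus, rPlus, rCosmo`, any `z₂ > 1`) obeying the boundary conditions (3.26) at `z = 1` and
`z = z₂` vanishes identically ("we deduce directly from (3.29) that `ũ = 0`").
[cite: CasalsTeixeiradacosta2022, Theorem 3.10 (proof, Step 2)] -/
theorem ctdcStep2_eq_zero (hsub : IsSubextremal M a Λ) (ha : 0 < a) {ω : ℂ} {m : ℝ} {lamBar : ℂ}
    (hω : 0 < ω.im) (hlam : (lamBar * conj ω).im ≤ 0)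
    (hwin : ¬(0 < ‖ω‖ ∧ ‖ω‖ < |m| * superradiantUpper M a Λ)) (s : ℝ) {z₂ : ℝ} (hz₂ : 1 < z₂)
    {R : ℝ → ℂ}
    (hR : IsTildeSolution (fun z => ctdcTildeV s (etaCauchy M a Λ ω m) (etaEvent M a Λ ω m)
      (etaCosmo M a Λ ω m) (ctdcLT M a Λ ω m lamBar) z₂ (rMinus M a Λ) (rPlus M a Λ) (rCosmo M a Λ) z)
      z₂ R)
    (h1 : IsTildeBranchAtOne M a Λ ω m R) (h2 : IsTildeBranchAtZ₂ M a Λ ω m z₂ R) :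
    ∀ z ∈ Ioo 1 z₂, R z = 0 := by
  have ha' : a ≠ 0 := ha.ne'
  refine tildeSolution_eq_zero_of_pos hz₂ hω
    (fun z hz => im_conj_mul_ctdcTildeV_pos hsub ha hω hlam hwin s hz₂ hz)
    (re_exponent_one_gt_half hsub ha' hω m) (re_exponent_z₂_gt_half hsub ha' hω m) hR ?_ ?_
  · obtain ⟨ε, hε, g, hg, hRg⟩ := h1
    exact ⟨ε, hε, g, hg, fun z hz => by simpa using hRg z hz⟩
  · obtain ⟨ε, hε, g, hg, hRg⟩ := h2
    refine ⟨ε, hε, g, hg, fun z hz => ?_⟩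
    rw [neg_neg]
    exact hRg z hz

/-- The same, starting from the NORMAL FORM (3.25) `z(z−1)(z−z₂)R̃″ + C̃(z)R̃ = 0` for any
coefficient `C̃` related to the printed `Ṽ` by `p·C̃ = −Ṽ + ½pp″ − ¼p′²` on `(1, z₂)` (for CTdC's
`C̃` of (3.25) this is exact algebra — pub-kds kit j166407 — and is supplied by the assembly file).
[cite: CasalsTeixeiradacosta2022, Corollary 3.10 (3.25)–(3.26) and Theorem 3.10 (proof, Step 2)] -/
theorem ctdcStep2_eq_zero_of_normalForm (hsub : IsSubextremal M a Λ) (ha : 0 < a) {ω : ℂ} {m : ℝ}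
    {lamBar : ℂ} (hω : 0 < ω.im) (hlam : (lamBar * conj ω).im ≤ 0)
    (hwin : ¬(0 < ‖ω‖ ∧ ‖ω‖ < |m| * superradiantUpper M a Λ)) (s : ℝ) {z₂ : ℝ} (hz₂ : 1 < z₂)
    {C : ℝ → ℂ} {R R' R'' : ℝ → ℂ}
    (hode : ∀ z ∈ Ioo 1 z₂, HasDerivAt R (R' z) z ∧ HasDerivAt R' (R'' z) z ∧
      ((z * (z - 1) * (z - z₂) : ℝ) : ℂ) * R'' z + C z * R z = 0)
    (hC : ∀ z ∈ Ioo 1 z₂, (ctdcP z₂ z : ℂ) * C z =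
      -ctdcTildeV s (etaCauchy M a Λ ω m) (etaEvent M a Λ ω m) (etaCosmo M a Λ ω m)
          (ctdcLT M a Λ ω m lamBar) z₂ (rMinus M a Λ) (rPlus M a Λ) (rCosmo M a Λ) z +
        ((ctdcP z₂ z * ctdcPDD z₂ z / 2 - ctdcPD z₂ z ^ 2 / 4 : ℝ) : ℂ))
    (h1 : IsTildeBranchAtOne M a Λ ω m R) (h2 : IsTildeBranchAtZ₂ M a Λ ω m z₂ R) :
    ∀ z ∈ Ioo 1 z₂, R z = 0 :=
  ctdcStep2_eq_zero hsub ha hω hlam hwin s hz₂ (isTildeSolution_of_normalForm hode hC) h1 h2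

end StepTwo

/-! ## Assembly for the pub-kds kernel `RouteW.SwappedEnergyVanishing`: `a ≥ 0`, CTdC's `z₂`,
the (3.25) coefficient `C̃`, the (3.26) branches as `R̃ = (z−1)^{½+η₀+η₁}h`, `R̃ = (z₂−z)^{½−η₀−η₂}g`

The case `a = 0` (Schwarzschild–de Sitter, inside CTdC's range `|a| < L`) is degenerate but harmless:
all `ϖ_j = 0`, so the `m²`-part of (3.28) vanishes identically; and `r₋ = 0`, where the PRINTED
(3.10) gives `η₀ = i L²Ξ(ω(r₀²+a²) − am)/|∏_{j'≠0}(r₀ − r_{j'})| = 0` exactly (`etaCauchy_zero_a`;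
the tree's route to this value is the junk arithmetic `κ₀ = |Δ′(0)|/(2ξ·0) = 0`, `η₀ = i(ω−mϖ₀)/(2·0) = 0`,
landing on the printed value), so the (3.26) exponents are `½ + η₁` at `z = 1` and `½ − η₂` at `z₂`,
real parts `> ½`. -/

section Assembly

open Literature.Analysis.ODE

variable {M a Λ : ℝ}

/-- At `a = 0` the tree's Cauchy-horizon surface gravity is the junk value `0` (`r₋ = 0`).
[cite: CasalsTeixeiradacosta2022, (3.10)] -/
theorem surfaceGravity_rMinus_zero_a (hsub : IsSubextremal M 0 Λ) :
    surfaceGravity M 0 Λ (rMinus M 0 Λ) = 0 := by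
  rw [rMinus_zero_a hsub]
  simp [surfaceGravity]

/-- Hence `Re η₀ = 0` at `a = 0`. [cite: CasalsTeixeiradacosta2022, (3.10)] -/
theorem etaCauchy_re_zero_a (hsub : IsSubextremal M 0 Λ) (ω : ℂ) (m : ℝ) :
    (etaCauchy M 0 Λ ω m).re = 0 := by
  rw [etaCauchy_re, surfaceGravity_rMinus_zero_a hsub]
  simp

/-- In fact `η₀ = 0` at `a = 0` — which IS the printed value: (3.10) reads
`η_j = (−1)^j i(ω − mϖ_j)/(2κ_j)` with `κ_j = |∏_{j'≠j}(r_j − r_{j'})|/(2L²Ξ(r_j²+a²))`, i.e.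
`η_j = (−1)^j i L²Ξ (ω(r_j²+a²) − am)/|∏_{j'≠j}(r_j − r_{j'})|`, and at `a = 0` (inside the paper's
range `|a| < L`) `r₀ = 0`, so the numerator vanishes while the denominator `r₁r₂|r₃|` does not
(only the intermediate `κ₀` is infinite, `1/κ₀ = 0`). The tree reaches the same value through the
junk arithmetic `κ₀ = |Δ′(0)|/(2ξ·0) = 0`, `i(ω − mϖ₀)/(2·0) = 0`.
[cite: CasalsTeixeiradacosta2022, (3.10) (p. 13 of arXiv v1)] -/
theorem etaCauchy_zero_a (hsub : IsSubextremal M 0 Λ) (ω : ℂ) (m : ℝ) :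
    etaCauchy M 0 Λ ω m = 0 := by
  unfold etaCauchy
  rw [surfaceGravity_rMinus_zero_a hsub]
  unfold etaOf
  simp

/-- `Re(½ + η₀ + η₁) > ½` for `Im ω > 0` on subextremal Kerr–de Sitter with `0 ≤ a`
(`a ≠ 0`: `κ₁ < κ₀`; `a = 0`: `Re η₀ = 0`). [cite: CasalsTeixeiradacosta2022, (3.10) and Corollary 3.10 (3.26)] -/
theorem re_half_add_eta_gt_half (hsub : IsSubextremal M a Λ) (ha : 0 ≤ a) {ω : ℂ} (hω : 0 < ω.im)
    (m : ℝ) : 1 / 2 < (1 / 2 + etaCauchy M a Λ ω m + etaEvent M a Λ ω m).re := by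
  rcases ha.eq_or_lt with h | h
  · subst h
    have hκ1 := surfaceGravity_rPlus_pos hsub
    simp only [add_re, etaCauchy_re_zero_a hsub, etaEvent_re]
    have h1 : 0 < ω.im / (2 * surfaceGravity M 0 Λ (rPlus M 0 Λ)) := div_pos hω (by positivity)
    have hre : ((1 : ℂ) / 2).re = 1 / 2 := by norm_num
    rw [hre]
    linarith
  · have e : (1 / 2 + etaCauchy M a Λ ω m + etaEvent M a Λ ω m) =
        etaCauchy M a Λ ω m + etaEvent M a Λ ω m + 1 / 2 := by ring
    rw [e]
    exact re_exponent_one_gt_half hsub h.ne' hω m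

/-- `Re(½ − η₀ − η₂) > ½` for `Im ω > 0` (`Re η₀ = −Im ω/(2κ₀) ≤ 0`, `Re η₂ = −Im ω/(2κ₂) < 0`; any `a`).
[cite: CasalsTeixeiradacosta2022, (3.10) and Corollary 3.10 (3.26)] -/
theorem re_half_sub_eta_gt_half (hsub : IsSubextremal M a Λ) {ω : ℂ} (hω : 0 < ω.im) (m : ℝ) :
    1 / 2 < (1 / 2 - etaCauchy M a Λ ω m - etaCosmo M a Λ ω m).re := by
  have hκ2 := surfaceGravity_rCosmo_pos hsub
  have hΛ := hsub.2.1
  simp only [sub_re, etaCauchy_re, etaCosmo_re]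
  have hsg : 0 ≤ surfaceGravity M a Λ (rMinus M a Λ) := by
    unfold surfaceGravity
    exact div_nonneg (abs_nonneg _)
      (mul_nonneg (mul_nonneg zero_le_two (xi_pos hΛ.le a).le) (by positivity))
  have h1 : 0 ≤ ω.im / (2 * surfaceGravity M a Λ (rMinus M a Λ)) :=
    div_nonneg hω.le (mul_nonneg zero_le_two hsg)
  have h2 : 0 < ω.im / (2 * surfaceGravity M a Λ (rCosmo M a Λ)) := div_pos hω (by positivity)
  have hre : ((1 : ℂ) / 2).re = 1 / 2 := by norm_num
  rw [hre]
  linarith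

/-- **`Im(ω̄ Ṽ(z)) > 0` on `(1, z₂)` at `a = 0`** (Schwarzschild–de Sitter): all `ϖ_j = 0`, so the
`m²`-part `B` of (3.28) vanishes identically (no superradiance condition is needed), `A > 0`, `E ≥ 0`,
and the `λ̄`-block contributes `−p·k·Im(ω̄λ̄) ≥ 0`. [cite: CasalsTeixeiradacosta2022, Theorem 3.10 (proof, Step 2), (3.28)] -/
theorem im_conj_mul_ctdcTildeV_pos_zero_a (hsub : IsSubextremal M 0 Λ) {ω : ℂ} (m : ℝ)
    {lamBar : ℂ} (hω : 0 < ω.im) (hlam : (lamBar * conj ω).im ≤ 0) (s : ℝ) {z₂ : ℝ} {z : ℝ}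
    (hz : z ∈ Ioo 1 z₂) :
    0 < (conj ω * ctdcTildeV s (etaCauchy M 0 Λ ω m) (etaEvent M 0 Λ ω m) (etaCosmo M 0 Λ ω m)
      (ctdcLT M 0 Λ ω m lamBar) z₂ (rMinus M 0 Λ) (rPlus M 0 Λ) (rCosmo M 0 Λ) z).im := by
  have h0 := rMinus_nonneg M 0 Λ
  have hκ1 := surfaceGravity_rPlus_pos hsub
  have hκ2 := surfaceGravity_rCosmo_pos hsub
  obtain ⟨hM, hΛ, h01, h12, -⟩ := hsub
  have e0 : etaCauchy M 0 Λ ω m =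
      I * ((((1 * (1 / (2 * surfaceGravity M 0 Λ (rMinus M 0 Λ)))) : ℝ) : ℂ) *
        (ω - ((m * 0 : ℝ) : ℂ))) := by
    unfold etaCauchy; rw [horizonAngVel_zero_a, etaOf_eq_I_mul]
  have e1 : etaEvent M 0 Λ ω m =
      I * (-(((1 * (1 / (2 * surfaceGravity M 0 Λ (rPlus M 0 Λ)))) : ℝ) : ℂ) *
        (ω - ((m * 0 : ℝ) : ℂ))) := by
    unfold etaEvent; rw [horizonAngVel_zero_a, etaOf_eq_I_mul]; push_cast; ring
  have e2 : etaCosmo M 0 Λ ω m =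
      I * ((((1 * (1 / (2 * surfaceGravity M 0 Λ (rCosmo M 0 Λ)))) : ℝ) : ℂ) *
        (ω - ((m * 0 : ℝ) : ℂ))) := by
    unfold etaCosmo; rw [horizonAngVel_zero_a, etaOf_eq_I_mul]
  rw [e0, e1, e2, im_conj_mul_ctdcTildeV_eq s _ _ _ _ _ _ 0, im_conj_mul_ctdcLT]
  set w₀ : ℝ := 1 * (1 / (2 * surfaceGravity M 0 Λ (rMinus M 0 Λ))) with hw₀
  set w₁ : ℝ := 1 * (1 / (2 * surfaceGravity M 0 Λ (rPlus M 0 Λ))) with hw₁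
  set w₂ : ℝ := 1 * (1 / (2 * surfaceGravity M 0 Λ (rCosmo M 0 Λ))) with hw₂
  set x := rMinus M 0 Λ with hx
  set y := rPlus M 0 Λ with hy
  set zc := rCosmo M 0 Λ with hzc
  have hp : 0 < ctdcP z₂ z := by
    unfold ctdcP; exact mul_pos (mul_pos (by linarith [hz.1]) (by linarith [hz.1])) (by linarith [hz.2])
  have hk₀ : 0 < 3 / Λ / ((zc + (x + y + zc)) * (y - x)) :=
    div_pos (div_pos (by norm_num) hΛ) (mul_pos (by linarith) (by linarith))
  have hE : 0 ≤ ctdcTildeE s z₂ x y zc z := ctdcTildeE_nonneg h0 h01 h12 ⟨hz.1.le, hz.2.le⟩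
  have hW : 0 < normSq ω := Complex.normSq_pos.2 (fun h => by rw [h] at hω; simp at hω)
  have hw₁p : 0 < w₁ := by rw [hw₁]; exact mul_pos one_pos (div_pos one_pos (mul_pos two_pos hκ1))
  have hw₂p : 0 < w₂ := by rw [hw₂]; exact mul_pos one_pos (div_pos one_pos (mul_pos two_pos hκ2))
  have hw12 : 0 < w₁ * w₂ := mul_pos hw₁p hw₂p
  have hA : 0 < tildeA w₀ w₁ w₂ 0 z₂ z := tildeA_pos hw12 (by linarith) hz
  have hB : tildeB w₀ w₁ w₂ 0 0 0 z₂ z = 0 := by unfold tildeB tildeS₂; ring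
  have hlam' : (conj ω * lamBar).im ≤ 0 := by rwa [mul_comm]
  rw [hB]
  have e3 : -(ctdcP z₂ z * (3 / Λ / ((zc + (x + y + zc)) * (y - x)) *
      ((conj ω * lamBar).im + xi 0 Λ ^ 2 * 0 ^ 2 * normSq ω * ω.im))) +
      ω.im * (ctdcTildeE s z₂ x y zc z + ctdcP z₂ z * 0 * normSq ω +
        z * (normSq ω * tildeA w₀ w₁ w₂ 0 z₂ z - m ^ 2 * 0)) =
      -(ctdcP z₂ z * (3 / Λ / ((zc + (x + y + zc)) * (y - x))) * (conj ω * lamBar).im) +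
      ω.im * (ctdcTildeE s z₂ x y zc z + z * (normSq ω * tildeA w₀ w₁ w₂ 0 z₂ z)) := by ring
  rw [e3]
  have t1 : 0 ≤ -(ctdcP z₂ z * (3 / Λ / ((zc + (x + y + zc)) * (y - x))) * (conj ω * lamBar).im) := by
    have := mul_nonneg (mul_pos hp hk₀).le (neg_nonneg.2 hlam')
    linarith
  have t2 : 0 < ω.im * (ctdcTildeE s z₂ x y zc z + z * (normSq ω * tildeA w₀ w₁ w₂ 0 z₂ z)) :=
    mul_pos hω (add_pos_of_nonneg_of_pos hE (mul_pos (by linarith [hz.1]) (mul_pos hW hA)))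
  linarith

/-- **`Im(ω̄ Ṽ(z)) > 0` on `(1, z₂)` for `0 ≤ a`** (subextremal; `Im ω > 0`, `Im(λ̄ω̄) ≤ 0`,
`|ω| ∉ |m|(0, Ω_SR)`; any `z₂ > 1`). [cite: CasalsTeixeiradacosta2022, Theorem 3.10 (proof, Step 2), (3.28)–(3.30)] -/
theorem im_conj_mul_ctdcTildeV_pos' (hsub : IsSubextremal M a Λ) (ha : 0 ≤ a) {ω : ℂ} {m : ℝ}
    {lamBar : ℂ} (hω : 0 < ω.im) (hlam : (lamBar * conj ω).im ≤ 0)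
    (hwin : ¬(0 < ‖ω‖ ∧ ‖ω‖ < |m| * superradiantUpper M a Λ)) (s : ℝ) {z₂ : ℝ} (hz₂ : 1 < z₂)
    {z : ℝ} (hz : z ∈ Ioo 1 z₂) :
    0 < (conj ω * ctdcTildeV s (etaCauchy M a Λ ω m) (etaEvent M a Λ ω m) (etaCosmo M a Λ ω m)
      (ctdcLT M a Λ ω m lamBar) z₂ (rMinus M a Λ) (rPlus M a Λ) (rCosmo M a Λ) z).im := by
  rcases ha.eq_or_lt with h | h
  · subst h
    exact im_conj_mul_ctdcTildeV_pos_zero_a hsub m hω hlam s hz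
  · exact im_conj_mul_ctdcTildeV_pos hsub h hω hlam hwin s hz₂ hz

/-- **Step 2 for `0 ≤ a`** (as `ctdcStep2_eq_zero`, with the `a = 0` case included).
[cite: CasalsTeixeiradacosta2022, Theorem 3.10 (proof, Step 2)] -/
theorem ctdcStep2_eq_zero' (hsub : IsSubextremal M a Λ) (ha : 0 ≤ a) {ω : ℂ} {m : ℝ} {lamBar : ℂ}
    (hω : 0 < ω.im) (hlam : (lamBar * conj ω).im ≤ 0)
    (hwin : ¬(0 < ‖ω‖ ∧ ‖ω‖ < |m| * superradiantUpper M a Λ)) (s : ℝ) {z₂ : ℝ} (hz₂ : 1 < z₂)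
    {R : ℝ → ℂ}
    (hR : IsTildeSolution (fun z => ctdcTildeV s (etaCauchy M a Λ ω m) (etaEvent M a Λ ω m)
      (etaCosmo M a Λ ω m) (ctdcLT M a Λ ω m lamBar) z₂ (rMinus M a Λ) (rPlus M a Λ) (rCosmo M a Λ) z)
      z₂ R)
    (h1 : ∃ ε : ℝ, 0 < ε ∧ ∃ g : ℝ → ℂ, ContDiffOn ℝ ((⊤ : ℕ∞) : WithTop ℕ∞) g (Ioo (1 - ε) (1 + ε)) ∧
      ∀ z ∈ Ioo 1 (1 + ε),
        R z = ((z - 1 : ℝ) : ℂ) ^ (1 / 2 + etaCauchy M a Λ ω m + etaEvent M a Λ ω m) * g z)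
    (h2 : ∃ ε : ℝ, 0 < ε ∧ ∃ g : ℝ → ℂ, ContDiffOn ℝ ((⊤ : ℕ∞) : WithTop ℕ∞) g (Ioo (z₂ - ε) (z₂ + ε)) ∧
      ∀ z ∈ Ioo (z₂ - ε) z₂,
        R z = ((z₂ - z : ℝ) : ℂ) ^ (1 / 2 - etaCauchy M a Λ ω m - etaCosmo M a Λ ω m) * g z) :
    ∀ z ∈ Ioo 1 z₂, R z = 0 := by
  refine tildeSolution_eq_zero_of_pos hz₂ hω
    (fun z hz => im_conj_mul_ctdcTildeV_pos' hsub ha hω hlam hwin s hz₂ hz)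
    (re_half_add_eta_gt_half hsub ha hω m) (re_half_sub_eta_gt_half hsub hω m) hR ?_ ?_
  · obtain ⟨ε, hε, g, hg, hRg⟩ := h1
    refine ⟨ε, hε, g, hg, fun z hz => ?_⟩
    have hu : ((z - 1 : ℝ) : ℂ) ≠ 0 := by
      exact_mod_cast (show (z - 1 : ℝ) ≠ 0 by linarith [hz.1])
    have hc : ((z - 1 : ℝ) : ℂ) ^ (1 / 2 + etaCauchy M a Λ ω m + etaEvent M a Λ ω m) ≠ 0 :=
      fun h0 => hu ((cpow_eq_zero_iff _ _).1 h0).1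
    rw [hRg z hz, cpow_neg, mul_right_comm, mul_inv_cancel₀ hc, one_mul]
  · obtain ⟨ε, hε, g, hg, hRg⟩ := h2
    refine ⟨ε, hε, g, hg, fun z hz => ?_⟩
    have hu : ((z₂ - z : ℝ) : ℂ) ≠ 0 := by
      exact_mod_cast (show (z₂ - z : ℝ) ≠ 0 by linarith [hz.2])
    have hc : ((z₂ - z : ℝ) : ℂ) ^ (1 / 2 - etaCauchy M a Λ ω m - etaCosmo M a Λ ω m) ≠ 0 :=
      fun h0 => hu ((cpow_eq_zero_iff _ _).1 h0).1
    rw [hRg z hz, cpow_neg, mul_right_comm, mul_inv_cancel₀ hc, one_mul]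

/-! ### CTdC's `z₂` and the (3.25) coefficient `C̃` -/

/-- CTdC's `z₂ > 1`: `z₂ − 1 = (r₀−r₃)(r₂−r₁)/((r₁−r₀)(r₂−r₃))` with `r₃ = −(r₀+r₁+r₂)`, for
`0 ≤ r₀ < r₁ < r₂`. [cite: CasalsTeixeiradacosta2022, Lemma 3.5 (3.14)] -/
theorem one_lt_ctdcZ₂ {r₀ r₁ r₂ : ℝ} (h0 : 0 ≤ r₀) (h01 : r₀ < r₁) (h12 : r₁ < r₂) :
    1 < ctdcZ₂ r₀ r₁ r₂ := by
  have hA : 0 < r₁ - r₀ := by linarith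
  have hB : 0 < r₂ + (r₀ + r₁ + r₂) := by linarith
  have e : ctdcZ₂ r₀ r₁ r₂ - 1 =
      (r₀ + (r₀ + r₁ + r₂)) * (r₂ - r₁) / ((r₁ - r₀) * (r₂ + (r₀ + r₁ + r₂))) := by
    unfold ctdcZ₂ ctdcZinf
    field_simp
    ring
  have h : 0 < ctdcZ₂ r₀ r₁ r₂ - 1 := by
    rw [e]; exact div_pos (mul_pos (by linarith) (by linarith)) (mul_pos hA hB)
  linarith

/-- `1 < z₂` on subextremal Kerr–de Sitter (`r₀, r₁, r₂ = rMinus, rPlus, rCosmo`).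
[cite: CasalsTeixeiradacosta2022, Lemma 3.5 (3.14)] -/
theorem one_lt_ctdcZ₂_kds (hsub : IsSubextremal M a Λ) :
    1 < ctdcZ₂ (rMinus M a Λ) (rPlus M a Λ) (rCosmo M a Λ) :=
  one_lt_ctdcZ₂ (rMinus_nonneg M a Λ) hsub.2.2.1 hsub.2.2.2.1

set_option maxRecDepth 8000 in
/-- **`p·C̃ = −Ṽ + ½pp″ − ¼p′²`**: the (3.25) coefficient `C̃` (`ctdcTildeCoeff`, for any `z₂` and
any `λ̄`-block `LT`) against the printed potential `Ṽ` of (3.27) — the Liouville substitution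
`ũ = p^{−1/2}R̃`, `d/dz* = p d/dz` as exact algebra (pub-kds kit j166407), off the singular points.
[cite: CasalsTeixeiradacosta2022, Corollary 3.10 (3.25) and Theorem 3.10 (proof, Step 2) (3.27)] -/
theorem ctdcP_mul_ctdcTildeCoeff (s : ℝ) (η₀ η₁ η₂ LT : ℂ) {z₂ r₀ r₁ r₂ z : ℝ}
    (h10 : r₁ - r₀ ≠ 0) (h23 : r₂ + (r₀ + r₁ + r₂) ≠ 0) (h12 : r₁ + r₂ ≠ 0)
    (hz0 : z ≠ 0) (hz1 : z - 1 ≠ 0) (hz2 : z₂ - z ≠ 0) :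
    (ctdcP z₂ z : ℂ) * ctdcTildeCoeff (s : ℂ) η₀ η₁ η₂ LT (z₂ : ℂ) r₀ r₁ r₂ z =
      -ctdcTildeV s η₀ η₁ η₂ LT z₂ r₀ r₁ r₂ z +
        ((ctdcP z₂ z * ctdcPDD z₂ z / 2 - ctdcPD z₂ z ^ 2 / 4 : ℝ) : ℂ) := by
  have h10' : (r₁ : ℂ) - (r₀ : ℂ) ≠ 0 := by exact_mod_cast h10
  have h23' : (r₂ : ℂ) + ((r₀ : ℂ) + (r₁ : ℂ) + (r₂ : ℂ)) ≠ 0 := by exact_mod_cast h23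
  have h12' : (r₁ : ℂ) + (r₂ : ℂ) ≠ 0 := by exact_mod_cast h12
  have hz0' : (z : ℂ) ≠ 0 := by exact_mod_cast hz0
  have hz1' : (z : ℂ) - 1 ≠ 0 := by exact_mod_cast hz1
  have hz2' : (z₂ : ℂ) - (z : ℂ) ≠ 0 := by exact_mod_cast hz2
  unfold ctdcTildeCoeff ctdcTildeV ctdcTildeE ctdcP ctdcPD ctdcPDD
  push_cast
  rw [show (r₁ : ℂ) ^ 2 + 2 * (r₂ : ℂ) * (r₁ : ℂ) + (r₂ : ℂ) ^ 2 = ((r₁ : ℂ) + (r₂ : ℂ)) ^ 2 by ring]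
  field_simp
  ring

/-- The `λ̄`-block in the cast placement of the pub-kds kernel (`RouteW.ltBlock`:
`(3/Λ)·(λ̄ − 2Ξ²amω + a²Ξ²ω²)/((r_c − r_neg)(r₊ − r₋))`, `r_neg = rNeg = −(r₋+r₊+r_c)`) is `ctdcLT`.
[cite: CasalsTeixeiradacosta2022, (3.25)] -/
theorem ltBlock_eq_ctdcLT (M a Λ s : ℝ) (ω : ℂ) (m : ℝ) (lam : ℂ) :
    ((3 / Λ : ℝ) : ℂ) *
        (lambdaBar a Λ s ω m lam - 2 * (xi a Λ : ℂ) ^ 2 * (a : ℂ) * (m : ℂ) * ω +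
          (a : ℂ) ^ 2 * (xi a Λ : ℂ) ^ 2 * ω ^ 2) /
      ((((rCosmo M a Λ - rNeg M a Λ) * (rPlus M a Λ - rMinus M a Λ)) : ℝ) : ℂ) =
    ctdcLT M a Λ ω m (lambdaBar a Λ s ω m lam) := by
  unfold ctdcLT rNeg
  push_cast
  ring

/-- Umetsu's leading coefficient at `a_H = z₂` on the real axis is `z(z−1)(z−z₂)`.
[cite: CasalsTeixeiradacosta2022, Corollary 3.10 (3.25)] -/
theorem generalHeun_lead_ofReal (z₂ z : ℝ) :
    GeneralHeun.lead ((z₂ : ℝ) : ℂ) z = ((z * (z - 1) * (z - z₂) : ℝ) : ℂ) := by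
  unfold GeneralHeun.lead
  push_cast
  ring

/-- **Casals–Teixeira da Costa, Theorem 3.10, Step 2 — in the shape of the pub-kds kernel
`RouteW.SwappedEnergyVanishing`.** On subextremal Kerr–de Sitter with `0 ≤ a`: if `Im ω > 0`,
`Im(λ̄·ω̄) ≤ 0` (`λ̄ = lambdaBar a Λ s ω m λ`) and `|ω| ∉ |m|(0, Ω_SR)`, then every `R̃` with
normal-form mode data — a classical solution of (3.25) `z(z−1)(z−z₂)R̃″ + C̃(z)R̃ = 0` on `(1, z₂)`
(`z₂ = ctdcZ₂ r₋ r₊ r_c` of (3.14), `C̃ = ctdcTildeCoeff` of (3.25) with the `λ̄`-block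
`(3/Λ)(λ̄ − 2Ξ²amω + a²Ξ²ω²)/((r_c−r_neg)(r₊−r₋))`), of the form `(z−1)^{½+η₀+η₁}·h` near `1⁺` and
`(z₂−z)^{½−η₀−η₂}·g` near `z₂⁻` with `h, g` smooth across — vanishes identically on `(1, z₂)`.
[cite: CasalsTeixeiradacosta2022, Corollary 3.10 (3.25)–(3.26) and Theorem 3.10 (proof, Step 2)] -/
theorem ctdcStep2_of_normalFormModeData (hsub : IsSubextremal M a Λ) (ha : 0 ≤ a) {s : ℝ} {ω : ℂ}
    {m : ℝ} {lam : ℂ} {R : ℝ → ℂ} (hω : 0 < ω.im)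
    (hlam : (lambdaBar a Λ s ω m lam * conj ω).im ≤ 0)
    (hwin : ¬(0 < ‖ω‖ ∧ ‖ω‖ < |m| * superradiantUpper M a Λ))
    (hode : ∃ R₁ R₂ : ℝ → ℂ, ∀ z ∈ Ioo 1 (ctdcZ₂ (rMinus M a Λ) (rPlus M a Λ) (rCosmo M a Λ)),
      HasDerivAt R (R₁ z) z ∧ HasDerivAt R₁ (R₂ z) z ∧
        GeneralHeun.lead ((ctdcZ₂ (rMinus M a Λ) (rPlus M a Λ) (rCosmo M a Λ) : ℝ) : ℂ) z * R₂ z +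
          ctdcTildeCoeff (s : ℂ) (etaCauchy M a Λ ω m) (etaEvent M a Λ ω m) (etaCosmo M a Λ ω m)
            (((3 / Λ : ℝ) : ℂ) *
                (lambdaBar a Λ s ω m lam - 2 * (xi a Λ : ℂ) ^ 2 * (a : ℂ) * (m : ℂ) * ω +
                  (a : ℂ) ^ 2 * (xi a Λ : ℂ) ^ 2 * ω ^ 2) /
              ((((rCosmo M a Λ - rNeg M a Λ) * (rPlus M a Λ - rMinus M a Λ)) : ℝ) : ℂ))
            ((ctdcZ₂ (rMinus M a Λ) (rPlus M a Λ) (rCosmo M a Λ) : ℝ) : ℂ)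
            (rMinus M a Λ) (rPlus M a Λ) (rCosmo M a Λ) z * R z = 0)
    (h1 : ∃ e : ℝ, 0 < e ∧ ∃ h : ℝ → ℂ, ContDiffOn ℝ ((⊤ : ℕ∞) : WithTop ℕ∞) h (Ioo (1 - e) (1 + e)) ∧
      ∀ z ∈ Ioo 1 (1 + e),
        R z = ((z - 1 : ℝ) : ℂ) ^ (1 / 2 + etaCauchy M a Λ ω m + etaEvent M a Λ ω m) * h z)
    (h2 : ∃ e : ℝ, 0 < e ∧ ∃ g : ℝ → ℂ, ContDiffOn ℝ ((⊤ : ℕ∞) : WithTop ℕ∞) g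
        (Ioo (ctdcZ₂ (rMinus M a Λ) (rPlus M a Λ) (rCosmo M a Λ) - e)
          (ctdcZ₂ (rMinus M a Λ) (rPlus M a Λ) (rCosmo M a Λ) + e)) ∧
      ∀ z ∈ Ioo (ctdcZ₂ (rMinus M a Λ) (rPlus M a Λ) (rCosmo M a Λ) - e)
          (ctdcZ₂ (rMinus M a Λ) (rPlus M a Λ) (rCosmo M a Λ)),
        R z = ((ctdcZ₂ (rMinus M a Λ) (rPlus M a Λ) (rCosmo M a Λ) - z : ℝ) : ℂ) ^
          (1 / 2 - etaCauchy M a Λ ω m - etaCosmo M a Λ ω m) * g z) :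
    ∀ z ∈ Ioo 1 (ctdcZ₂ (rMinus M a Λ) (rPlus M a Λ) (rCosmo M a Λ)), R z = 0 := by
  set z₂ := ctdcZ₂ (rMinus M a Λ) (rPlus M a Λ) (rCosmo M a Λ) with hz₂def
  have hz₂ : 1 < z₂ := one_lt_ctdcZ₂_kds hsub
  have h0 := rMinus_nonneg M a Λ
  obtain ⟨R₁, R₂, hode⟩ := hode
  rw [ltBlock_eq_ctdcLT] at hode
  refine ctdcStep2_eq_zero' hsub ha hω hlam hwin s hz₂ (isTildeSolution_of_normalForm
    (C := fun z => ctdcTildeCoeff (s : ℂ) (etaCauchy M a Λ ω m) (etaEvent M a Λ ω m)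
      (etaCosmo M a Λ ω m) (ctdcLT M a Λ ω m (lambdaBar a Λ s ω m lam)) (z₂ : ℂ)
      (rMinus M a Λ) (rPlus M a Λ) (rCosmo M a Λ) z) (R' := R₁) (R'' := R₂) ?_ ?_) h1 h2
  · intro z hz
    obtain ⟨hd1, hd2, heq⟩ := hode z hz
    refine ⟨hd1, hd2, ?_⟩
    rw [← generalHeun_lead_ofReal]
    exact heq
  · intro z hz
    obtain ⟨hM, hΛ, h01, h12, -⟩ := hsub
    exact ctdcP_mul_ctdcTildeCoeff s _ _ _ _ (by linarith) (by linarith) (by linarith)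
      (by linarith [hz.1]) (by linarith [hz.1]) (by linarith [hz.2])

end Assembly

end Literature.Geometry.Lorentzian.KerrDeSitter
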